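import Mathlib.MeasureTheory.Measure.Lebesgue.VolumeOfBalls
import Mathlib.Analysis.Calculus.BumpFunction.FiniteDimension
import Literature.Analysis.PDE.DecayBootstrap
import Literature.Analysis.PDE.LaplacianInequalities
import Literature.Analysis.Potential.GreenRepresentationDecay
import Literature.Geometry.Lorentzian.LaplaceBeltramiChartForm
import Literature.Geometry.Lorentzian.EndVolume
import Literature.Geometry.Lorentzian.ExteriorRegionSchwarzschildEnd
import Literature.Geometry.Lorentzian.HarmonicallyFlatPotential
import Literature.Geometry.Lorentzian.ScalarCurvatureMoment
import Literature.Geometry.Lorentzian.RicciChartDecay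
import HarnessLib

/-!
# The asymptotic expansion `v̂ = A/r + O₂(r⁻²)` of the conformal factor (Schoen–Yau 1979,
# Lemma 3.2, asymptotic half)

Schoen–Yau, *On the proof of the positive mass conjecture in general relativity*, Comm. Math.
Phys. 65 (1979), Lemma 3.2 (pp. 64–70) with Lemma 3.3 (p. 71): on a `3`-manifold with one
asymptotically flat end on which `h = δ + O''(r⁻²)`, the solution `v` of the linear equation
`Δ_h v − (R/8) v = R/8` ((3.1) with `f = h = R/8`, (3.23)) satisfies `v = A/r + ω` with
`ω = O(r⁻²)`, `∂ω = O(r⁻³)`, `∂²ω = O(r⁻⁴)` in the chart of the end ((3.6)–(3.20)). This file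
proves exactly the hypothesis `hasym` of
`exists_conformal_negativeMass_of_massZero_of_regularity_and_asymptotics`
(`ConformalScalarFlatElliptic.lean`):

* `endValue_expansion_of_conformal_solution` — **for every smooth `v ∈ L⁶(dV_h)` solving
  `Δ_h v − (R/8) v = R/8` on data with a strongly asymptotically flat end (`h − δ = o₅(r⁻²)`)
  there is `A` with `‖∂^m (v̂ − A/r)(x)‖ = O(|x|^{−2−m})` for `m ≤ 2`** (`v̂ = endValue e v`).

## The proof (following (3.6)–(3.20), with the flat interior `L²` theory in place of Schauder)

In the chart the equation reads `Σ aₖₗ ∂ₗ∂ₖ v̂ + Σ βₘ ∂ₘ v̂ − (R∘Φ/8) v̂ = R∘Φ/8`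
(`AFEnd.chartEquation`; `LaplaceBeltramiChartForm.lean`) with `Σ|a − δ| ≤ Kr⁻²`,
`Σ|β| ≤ Kr⁻³`, `|R∘Φ| ≤ Kr⁻⁴` and the corresponding derivative bounds
(`AFEnd.exists_bootstrapCoeff`, from `AFEnd.exists_chartCoeff_bounds`).

1. `AFEnd.exists_ball_sq_integral_le_of_memLp` — `v ∈ L⁶(dV_h)` gives
   `∫_{B̄(x,|x|/4)} v̂² ≤ K₀|x|²` (chart change of variables `EndVolume.lean`, `√det h ≥ 1/2`,
   and `t² ≤ r²t⁶ + r⁻¹`); this is how (3.5) enters.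
2. `AFEnd.bootstrap_stage` — one run of `Literature.Analysis.PDE.decay_bootstrap`
   (`DecayBootstrap.lean`; three levels of interior `L²`/sup estimates on the balls
   `B̄(x, |x|/4)`): `∫_{B̄(x,|x|/4)} u² ≤ K₀ |x|^q` implies `|u| ≲ r^{(q−3)/2}`,
   `|∂u| ≲ r^{(q−5)/2}`, `|∂²u| ≲ r^{(q−7)/2}`. With `q = 2`: `v̂, ∂v̂, ∂²v̂ = O(r^{−1/2−k})`.
3. `exists_inv_norm_bound_of_laplacian_decay` — the flat Laplacian of `v̂` is then `O(r⁻⁴)`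
   (`abs_laplacian_sub_source_le`), so Green's representation of a cut-off of `v̂`
   (`exists_smooth_cutoff_mul`, `Literature.Analysis.Potential.isBigO_inv_norm_of_laplacian_decay`)
   gives `v̂ = O(r⁻¹)` — (3.9). A second bootstrap (`q = 1`) gives `∂ᵏv̂ = O(r^{−1−k})`.
4. `AFEnd.exists_monopole_of_laplacian` — now `Δv̂ = R∘Φ/8 + O(r⁻⁵)`; the truncated first
   moments of `R∘Φ` are bounded (`AFEnd.exists_bound_norm_setIntegral_scalarCurvatureCoeff_smul`,
   `ScalarCurvatureMoment.lean`), so the monopole expansion of the Newtonian potential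
   (`Literature.Analysis.Potential.isBigO_sub_integral_laplacian_mul_inv_norm`) gives
   `v̂ = A/r + O(r⁻²)` pointwise — (3.12)–(3.18). (For a general `O(r⁻⁴)` source the remainder
   would only be `O(r⁻² log r)`; the moment bound is what the paper uses implicitly.)
5. `sub_monopole_equation`, `AFEnd.isBigOSmooth_monopoleError` — `Ω = v̂ − A/r` solves the
   same equation with source `R∘Φ/8 − A·E`, `E = Σ (a−δ)∂∂(1/r) + Σ β∂(1/r) − (R∘Φ/8)/r`
   `∈ O_2(r⁻⁵)` (`1/r` is harmonic, `MetricCoord.sum_fderiv_fderiv_inv_norm`), and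
   `∫_{B̄(x,|x|/4)} Ω² ≲ |x|⁻¹`; a third bootstrap (`q = −1`) gives `∂ᵏΩ = O(r^{−2−k})`,
   `k ≤ 2` — (3.19)–(3.20) — and the norms of the first two Fréchet derivatives are bounded by
   the partial derivatives (`norm_iteratedFDeriv_one_le_sum`, `norm_iteratedFDeriv_two_le_sum`).

Everything here is proved; nothing is defined and no named fact is introduced.

## References

* R. Schoen, S.-T. Yau, *On the proof of the positive mass conjecture in general relativity*,
  Comm. Math. Phys. 65 (1979) 45–76, Lemma 3.2 (3.5)–(3.20), Lemma 3.3 (3.23), pp. 64–71.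
  [SchoenYauPMT1979]
* D. Gilbarg, N. S. Trudinger, *Elliptic partial differential equations of second order*,
  Springer 2001, (2.17) (Green's representation). [GilbargTrudinger2001]
-/

noncomputable section

set_option maxSynthPendingDepth 3

open Set Function Filter Metric MeasureTheory Measure TopologicalSpace Bornology Asymptotics Manifold Bundle
open scoped Topology Manifold ContDiff RealInnerProductSpace Laplacian ENNReal

namespace Literature.Geometry.Lorentzian

open Literature.Analysis.PDE (norm_ge_of_mem_closedBall rpow_neg_le_of_mem_closedBall
  partials_congr_of_eventuallyEq laplacian_eq_sum_of_contDiffAt decay_bootstrap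
  fderiv_fderiv_apply_eq_fderiv_fderiv)
open Literature.Analysis.Potential (isBigO_inv_norm_of_laplacian_decay
  isBigO_sub_integral_laplacian_mul_inv_norm)
open InnerProductSpace (laplacian_congr_nhds)

/- ═══════════ L6 ═══════════ -/

/-- `t² ≤ r² t⁶ + r⁻¹` for `r ≥ 1` (if `t² ≥ r⁻¹` then `r² t⁴ ≥ 1`). [folklore] -/
theorem sq_le_sq_mul_pow_six_add_inv {r : ℝ} (hr : 1 ≤ r) (t : ℝ) :
    t ^ 2 ≤ r ^ 2 * t ^ 6 + r⁻¹ := by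
  have hr0 : 0 < r := by linarith
  have hri : 0 < r⁻¹ := inv_pos.2 hr0
  rcases le_or_gt (t ^ 2) r⁻¹ with h | h
  · nlinarith [sq_nonneg (t ^ 3), sq_nonneg r]
  · have h1 : 1 ≤ r * t ^ 2 := by
      have := mul_le_mul_of_nonneg_left h.le hr0.le
      rwa [mul_inv_cancel₀ hr0.ne'] at this
    have h2 : 1 ≤ r ^ 2 * t ^ 4 := by nlinarith [h1, sq_nonneg t]
    have ht2 : 0 ≤ t ^ 2 := sq_nonneg t
    calc t ^ 2 = t ^ 2 * 1 := (mul_one _).symm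
      _ ≤ t ^ 2 * (r ^ 2 * t ^ 4) := mul_le_mul_of_nonneg_left h2 ht2
      _ = r ^ 2 * t ^ 6 := by ring
      _ ≤ r ^ 2 * t ^ 6 + r⁻¹ := by linarith

namespace AFEnd

variable {X : Type} [TopologicalSpace X] [ChartedSpace E3 X] [IsManifold (𝓡 3) ∞ X]
  [T2Space X] [LocallyCompactSpace X] [MeasurableSpace X] [BorelSpace X]
  (e : AFEnd X) (D : InitialDataSet (𝓡 3) X)

/-- **`L⁶` functions have `O(1)` sixth moments over far chart regions**: if `v ∈ L⁶(dV_h)` is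
continuous then `∫_A v̂⁶ dz ≤ 2 ∫ |v|⁶ dV_h` for every measurable `A` in the region where
`√(det h_{ij}) ≥ 1/2` (`v̂ = v ∘ Φ` the chart representative). [folklore] -/
theorem setIntegral_endValue_pow_six_le {α : ℝ} (hα : 0 < α) (hAF : e.IsMetricAsymptoticallyFlat D α)
    {v : X → ℝ} (hvc : Continuous v) (hv6 : MemLp v 6 (riemannianMeasure D.h)) :
    ∃ R₃ : ℝ, e.R ≤ R₃ ∧ ∀ A : Set E3, MeasurableSet A → A ⊆ {z | R₃ < ‖z‖} →
      IntegrableOn (fun z ↦ endValue e v z ^ 6) A ∧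
      ∫ z in A, endValue e v z ^ 6 ≤ 2 * ∫ p, |v p| ^ 6 ∂(riemannianMeasure D.h) := by
  set μ : Measure X := riemannianMeasure D.h with hμ
  obtain ⟨R₃, hR₃⟩ := e.exists_radius_half_le_sqrt_det_hCoeff D hα hAF
  refine ⟨max e.R R₃, le_max_left _ _, fun A hA hA' ↦ ?_⟩
  have hAR : A ⊆ {z | e.R < ‖z‖} := fun z hz ↦
    show e.R < ‖z‖ from lt_of_le_of_lt (le_max_left _ _) (hA' hz)
  have hA3 : ∀ z ∈ A, R₃ ≤ ‖z‖ := fun z hz ↦ (le_max_right _ _).trans (hA' hz).le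
  -- `|v|⁶` is integrable
  have hI6 : Integrable (fun p ↦ |v p| ^ 6) μ := by
    have h := hv6.integrable_norm_rpow (by norm_num) (by norm_num)
    refine h.congr (Eventually.of_forall fun p ↦ ?_)
    simp only [ENNReal.toReal_ofNat, Real.norm_eq_abs]
    rw [show (6 : ℝ) = ((6 : ℕ) : ℝ) by norm_num, Real.rpow_natCast]
  set M : ℝ := ∫ p, |v p| ^ 6 ∂μ with hM
  have hM0 : 0 ≤ M := integral_nonneg fun p ↦ by positivity
  -- the chart formula for `g = ofReal |v|⁶`
  set g : X → ℝ≥0∞ := fun p ↦ ENNReal.ofReal (|v p| ^ 6) with hg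
  have hchart := e.setLIntegral_image_dataChartExt D g hA hAR
  have hleft : ∫⁻ p in e.dataChartExt '' A, g p ∂μ ≤ ENNReal.ofReal M := by
    calc ∫⁻ p in e.dataChartExt '' A, g p ∂μ ≤ ∫⁻ p, g p ∂μ := setLIntegral_le_lintegral _ _
      _ = ENNReal.ofReal M := by
          rw [hM, ofReal_integral_eq_lintegral_ofReal hI6 (Eventually.of_forall fun p ↦ by positivity)]
  -- the representative and its measurability on `A`
  have hrep : ∀ z ∈ A, |v (e.dataChartExt z)| ^ 6 = endValue e v z ^ 6 := fun z hz ↦ by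
    rw [e.dataChartExt_of_lt (hAR hz), ← endValue_of_lt e v (hAR hz)]
    rw [show (6 : ℕ) = 2 * 3 by norm_num, pow_mul, pow_mul, sq_abs]
  have hfar_open : IsOpen {z : E3 | e.R < ‖z‖} := isOpen_lt continuous_const continuous_norm
  have hcontR : ContinuousOn (fun z ↦ endValue e v z) {z : E3 | e.R < ‖z‖} := by
    have h1 : ContinuousOn (fun z ↦ v (e.dataChartExt z)) {z : E3 | e.R < ‖z‖} := fun z hz ↦
      (hvc.continuousAt.comp (e.contMDiffAt_dataChartExt hz).continuousAt).continuousWithinAt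
    exact h1.congr fun z hz ↦ by
      show endValue e v z = v (e.dataChartExt z)
      rw [endValue_of_lt e v hz, e.dataChartExt_of_lt hz]
  have hcont : ContinuousOn (fun z ↦ endValue e v z ^ 6) A := (hcontR.mono hAR).pow 6
  have hmeas : AEStronglyMeasurable (fun z ↦ endValue e v z ^ 6) (volume.restrict A) :=
    hcont.aestronglyMeasurable hA
  -- the right-hand side of the chart formula dominates `(1/2) ∫⁻_A ofReal (v̂⁶)`
  have hright : ∫⁻ z in A, ENNReal.ofReal (endValue e v z ^ 6) * ENNReal.ofReal (1 / 2) ≤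
      ∫⁻ z in A, g (e.dataChartExt z) * ENNReal.ofReal (Real.sqrt (Matrix.of fun i j ↦
        hCoeff e D z (EuclideanSpace.single i 1) (EuclideanSpace.single j 1)).det) := by
    refine setLIntegral_mono' hA fun z hz ↦ ?_
    rw [hg]
    simp only
    rw [hrep z hz]
    exact mul_le_mul' le_rfl (ENNReal.ofReal_le_ofReal (hR₃ z (hA3 z hz)))
  have hhalf : ∫⁻ z in A, ENNReal.ofReal (endValue e v z ^ 6) * ENNReal.ofReal (1 / 2) =
      (∫⁻ z in A, ENNReal.ofReal (endValue e v z ^ 6)) * ENNReal.ofReal (1 / 2) :=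
    lintegral_mul_const' _ _ ENNReal.ofReal_ne_top
  have hlin : ∫⁻ z in A, ENNReal.ofReal (endValue e v z ^ 6) ≤ 2 * ENNReal.ofReal M := by
    have h := (hhalf.symm.trans_le hright).trans (hchart.symm.le.trans hleft)
    have h2 : ENNReal.ofReal (1 / 2) = 2⁻¹ := by
      rw [one_div, ENNReal.ofReal_inv_of_pos two_pos, ENNReal.ofReal_ofNat]
    rw [h2] at h
    calc ∫⁻ z in A, ENNReal.ofReal (endValue e v z ^ 6)
        = (∫⁻ z in A, ENNReal.ofReal (endValue e v z ^ 6)) * 2⁻¹ * 2 := by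
          rw [mul_assoc, ENNReal.inv_mul_cancel two_ne_zero ENNReal.ofNat_ne_top, mul_one]
      _ ≤ ENNReal.ofReal M * 2 := mul_le_mul' h le_rfl
      _ = 2 * ENNReal.ofReal M := mul_comm _ _
  have hfin : ∫⁻ z in A, ENNReal.ofReal (endValue e v z ^ 6) < ⊤ :=
    lt_of_le_of_lt hlin (ENNReal.mul_lt_top ENNReal.ofNat_lt_top ENNReal.ofReal_lt_top)
  -- integrability and the real bound
  have hint : IntegrableOn (fun z ↦ endValue e v z ^ 6) A := by
    refine ⟨hmeas, ?_⟩
    rw [hasFiniteIntegral_iff_ofReal (ae_of_all _ fun z ↦ by positivity)]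
    exact hfin
  refine ⟨hint, ?_⟩
  rw [integral_eq_lintegral_of_nonneg_ae (ae_of_all _ fun z ↦ by positivity) hmeas]
  have h2M : (2 * ENNReal.ofReal M).toReal = 2 * M := by
    rw [ENNReal.toReal_mul, ENNReal.toReal_ofNat, ENNReal.toReal_ofReal hM0]
  rw [← h2M]
  exact ENNReal.toReal_mono (ENNReal.mul_ne_top ENNReal.ofNat_ne_top ENNReal.ofReal_ne_top) hlin

/-- **The `L²` input of the decay bootstrap from `v ∈ L⁶(dV_h)`**: for a continuous
`v ∈ L⁶(dV_h)`, `∫_{B̄(x,|x|/4)} v̂² ≤ K₀ |x|²` for `|x|` large (`t² ≤ r²t⁶ + r⁻¹` integrated over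
the ball, whose volume is `≤ r³/10`). This is how (3.5) (`‖v‖₆ < ∞`) enters the pointwise
estimates (3.9) of Schoen–Yau's Lemma 3.2. [cite: SchoenYauPMT1979, Lemma 3.2, (3.5)–(3.9)] -/
theorem exists_ball_sq_integral_le_of_memLp {α : ℝ} (hα : 0 < α)
    (hAF : e.IsMetricAsymptoticallyFlat D α)
    {v : X → ℝ} (hvc : Continuous v) (hv6 : MemLp v 6 (riemannianMeasure D.h)) :
    ∃ K₀ r₀ : ℝ, 0 ≤ K₀ ∧ ∀ x : E3, r₀ ≤ ‖x‖ →
      ∫ y in closedBall x (1 / 4 * ‖x‖), endValue e v y ^ 2 ≤ K₀ * ‖x‖ ^ (2 : ℝ) := by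
  obtain ⟨R₃, hRR₃, hA⟩ := e.setIntegral_endValue_pow_six_le D hα hAF hvc hv6
  set M : ℝ := ∫ p, |v p| ^ 6 ∂(riemannianMeasure D.h) with hM
  have hM0 : 0 ≤ M := integral_nonneg fun p ↦ by positivity
  refine ⟨2 * M + 1, 4 * (|R₃| + 1), by positivity, fun x hx ↦ ?_⟩
  obtain ⟨r, hr⟩ : ∃ r : ℝ, r = ‖x‖ := ⟨_, rfl⟩
  rw [← hr] at hx ⊢
  have hr1 : 1 ≤ r := by linarith [abs_nonneg R₃]
  have hr0 : 0 < r := by linarith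
  set B : Set E3 := closedBall x (1 / 4 * r) with hB
  -- the ball lies in the far region
  have hBfar : B ⊆ {z : E3 | R₃ < ‖z‖} := by
    intro y hy
    rw [hB, mem_closedBall, dist_eq_norm] at hy
    have h1 : ‖x‖ ≤ ‖y‖ + ‖y - x‖ := by
      calc ‖x‖ = ‖y - (y - x)‖ := by rw [sub_sub_cancel]
        _ ≤ ‖y‖ + ‖y - x‖ := norm_sub_le _ _
    show R₃ < ‖y‖
    linarith [le_abs_self R₃]
  obtain ⟨hint6, h6⟩ := hA B measurableSet_closedBall hBfar
  have hBR : B ⊆ {z : E3 | e.R < ‖z‖} := fun z hz ↦ lt_of_le_of_lt hRR₃ (hBfar hz)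
  -- continuity of `v̂` on `B`
  have hcontR : ContinuousOn (fun z ↦ endValue e v z) {z : E3 | e.R < ‖z‖} := by
    have h1 : ContinuousOn (fun z ↦ v (e.dataChartExt z)) {z : E3 | e.R < ‖z‖} := fun z hz ↦
      (hvc.continuousAt.comp (e.contMDiffAt_dataChartExt hz).continuousAt).continuousWithinAt
    exact h1.congr fun z hz ↦ by
      show endValue e v z = v (e.dataChartExt z)
      rw [endValue_of_lt e v hz, e.dataChartExt_of_lt hz]
  have hK : IsCompact B := isCompact_closedBall _ _
  have hint2 : IntegrableOn (fun z ↦ endValue e v z ^ 2) B :=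
    ((hcontR.mono hBR).pow 2).integrableOn_compact hK
  have hvolB : (volume B).toReal = (1 / 4 * r) ^ 3 * (Real.pi * 4 / 3) := by
    rw [hB, EuclideanSpace.volume_closedBall_fin_three, ENNReal.toReal_mul, ENNReal.toReal_pow,
      ENNReal.toReal_ofReal (by positivity), ENNReal.toReal_ofReal (by positivity)]
  have hfinB : volume B < ⊤ := measure_closedBall_lt_top
  have hdom : IntegrableOn (fun z ↦ r ^ 2 * endValue e v z ^ 6 + r⁻¹) B :=
    (hint6.const_mul _).add (integrableOn_const hfinB.ne)
  calc ∫ y in B, endValue e v y ^ 2 ≤ ∫ y in B, (r ^ 2 * endValue e v y ^ 6 + r⁻¹) :=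
        setIntegral_mono_on hint2 hdom measurableSet_closedBall fun y _ ↦
          sq_le_sq_mul_pow_six_add_inv hr1 _
    _ = r ^ 2 * (∫ y in B, endValue e v y ^ 6) + r⁻¹ * (volume B).toReal := by
        rw [integral_add (hint6.const_mul _) (integrableOn_const hfinB.ne), integral_const_mul,
          setIntegral_const, measureReal_def, smul_eq_mul, mul_comm (volume B).toReal]
    _ ≤ r ^ 2 * (2 * M) + r⁻¹ * ((1 / 4 * r) ^ 3 * (Real.pi * 4 / 3)) := by
        rw [hvolB]
        have := mul_le_mul_of_nonneg_left h6 (sq_nonneg r)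
        linarith
    _ ≤ (2 * M + 1) * r ^ (2 : ℝ) := by
        rw [Real.rpow_two]
        have hπ : Real.pi * 4 / 3 ≤ 6 := by linarith [Real.pi_le_four]
        have e1 : r⁻¹ * ((1 / 4 * r) ^ 3 * (Real.pi * 4 / 3)) = r ^ 2 * ((Real.pi * 4 / 3) / 64) := by
          field_simp
          ring
        rw [e1]
        nlinarith [sq_nonneg r, hM0]

end AFEnd

/- ═══════════ Body1 ═══════════ -/

/-! ### Elementary conversions -/

/-- From `u² ≤ C r^p` to `|u| ≤ √C r^{p/2}` (`r > 0`). [folklore] -/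
theorem abs_le_sqrt_mul_rpow_half {u C r p : ℝ} (hr : 0 < r) (h : u ^ 2 ≤ C * r ^ p) :
    |u| ≤ Real.sqrt C * r ^ (p / 2) := by
  have hC : 0 ≤ C * r ^ p := (sq_nonneg u).trans h
  have hrp : 0 < r ^ p := Real.rpow_pos_of_pos hr p
  have hC0 : 0 ≤ C := by
    by_contra hneg
    have : C * r ^ p < 0 := mul_neg_of_neg_of_pos (lt_of_not_ge hneg) hrp
    linarith
  rw [← Real.sqrt_sq (abs_nonneg u), sq_abs]
  have hsq : Real.sqrt (r ^ p) = r ^ (p / 2) := by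
    rw [Real.sqrt_eq_rpow (r ^ p), ← Real.rpow_mul hr.le]
    congr 1
    ring
  calc Real.sqrt (u ^ 2) ≤ Real.sqrt (C * r ^ p) := Real.sqrt_le_sqrt h
    _ = Real.sqrt C * Real.sqrt (r ^ p) := Real.sqrt_mul hC0 _
    _ = Real.sqrt C * r ^ (p / 2) := by rw [hsq]

/-! ### Integrated source bounds over the balls `B̄(x, |x|/4)` from symbol estimates -/

/-- **Source bounds for the decay bootstrap**: if `g ∈ O_2(r⁻⁴)` then, along an orthonormal basis
`b` of `ℝ³`, `∫_{B̄(x,|x|/4)} g² ≤ K|x|⁻⁵`, `∫ (∂ₘg)² ≤ K|x|⁻⁷`, `∫ (∂ₙ∂ₘg)² ≤ K|x|⁻⁹` for `|x|`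
large (pointwise bounds times the volume `≤ 6(|x|/4)³`). [folklore] -/
theorem exists_sourceBounds_of_isBigOSmooth (b : OrthonormalBasis (Fin 3) ℝ E3) {g : E3 → ℝ}
    (hg : IsBigOSmooth 2 (-4) g) :
    ∃ K r₁ : ℝ, 0 ≤ K ∧ ∀ x : E3, r₁ ≤ ‖x‖ →
      (∫ y in closedBall x (1 / 4 * ‖x‖), g y ^ 2) ≤ K * ‖x‖ ^ (-5 : ℝ) ∧
      (∀ m, (∫ y in closedBall x (1 / 4 * ‖x‖), (fderiv ℝ g y (b m)) ^ 2) ≤ K * ‖x‖ ^ (-7 : ℝ)) ∧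
      (∀ m n, (∫ y in closedBall x (1 / 4 * ‖x‖),
          (fderiv ℝ (fun z => fderiv ℝ g z (b m)) y (b n)) ^ 2) ≤ K * ‖x‖ ^ (-9 : ℝ)) := by
  have hb1 : ∀ i, ‖b i‖ ≤ 1 := fun i => (b.orthonormal.1 i).le
  obtain ⟨C, r₀, hC, h⟩ := exists_partial_bounds_of_isBigOSmooth hg
  refine ⟨6 * 64 * C ^ 2, max (4 / 3 * r₀) 1, by positivity, fun x hx => ?_⟩
  obtain ⟨r, hr⟩ : ∃ r : ℝ, r = ‖x‖ := ⟨_, rfl⟩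
  rw [← hr] at hx ⊢
  have hr1 : 1 ≤ r := le_trans (le_max_right _ _) hx
  have hr0 : 0 < r := by linarith
  have hx0 : 0 < ‖x‖ := by rwa [← hr]
  have hquarter : (1 / 4 : ℝ) ≤ 1 / 4 := le_rfl
  -- points of the ball are far out, with comparable radius
  have hyfar : ∀ y ∈ closedBall x (1 / 4 * r), r₀ ≤ ‖y‖ := fun y hy => by
    have h34 : 3 / 4 * ‖x‖ ≤ ‖y‖ := norm_ge_of_mem_closedBall hquarter (by rwa [← hr])
    have : 4 / 3 * r₀ ≤ r := le_trans (le_max_left _ _) hx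
    rw [hr] at this
    linarith
  have hypow : ∀ y ∈ closedBall x (1 / 4 * r), ∀ p : ℝ, 0 ≤ p → ‖y‖ ^ (-p) ≤ (4 / 3) ^ p * r ^ (-p) :=
    fun y hy p hp => by
      rw [hr]; exact rpow_neg_le_of_mem_closedBall hquarter hx0 hp (by rwa [← hr])
  -- `(4/3)^p ≤ 8` for `p ≤ 6` and the radius identity
  have h43 : ∀ p : ℝ, 0 ≤ p → p ≤ 6 → (4 / 3 : ℝ) ^ p ≤ 8 := fun p hp0 hp6 => by
    calc (4 / 3 : ℝ) ^ p ≤ (4 / 3 : ℝ) ^ (6 : ℝ) :=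
          Real.rpow_le_rpow_of_exponent_le (by norm_num) hp6
      _ ≤ 8 := by norm_num
  have hvol : ∀ p : ℝ, 6 * (8 * C * r ^ (-p)) ^ 2 * (1 / 4 * r) ^ 3 =
      6 * 64 * C ^ 2 / 64 * (r ^ (-p) * r ^ (-p) * r ^ 3) := fun p => by ring
  have hpow : ∀ p : ℝ, r ^ (-p) * r ^ (-p) * r ^ 3 = r ^ (-(2 * p) + 3) := fun p => by
    rw [← Real.rpow_add hr0, ← Real.rpow_natCast, ← Real.rpow_add hr0]
    congr 1; push_cast; ring
  -- the generic step
  have step : ∀ {f : E3 → ℝ} {p : ℝ}, 0 ≤ p → p ≤ 6 →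
      (∀ y ∈ closedBall x (1 / 4 * r), |f y| ≤ C * ‖y‖ ^ (-p)) →
      ∫ y in closedBall x (1 / 4 * r), f y ^ 2 ≤ 6 * 64 * C ^ 2 * r ^ (-(2 * p) + 3) := by
    intro f p hp0 hp6 hf
    have hM : ∀ y ∈ closedBall x (1 / 4 * r), |f y| ≤ 8 * C * r ^ (-p) := fun y hy => by
      calc |f y| ≤ C * ‖y‖ ^ (-p) := hf y hy
        _ ≤ C * ((4 / 3) ^ p * r ^ (-p)) := mul_le_mul_of_nonneg_left (hypow y hy p hp0) hC
        _ ≤ C * (8 * r ^ (-p)) := by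
            refine mul_le_mul_of_nonneg_left ?_ hC
            exact mul_le_mul_of_nonneg_right (h43 p hp0 hp6) (Real.rpow_nonneg hr0.le _)
        _ = 8 * C * r ^ (-p) := by ring
    calc ∫ y in closedBall x (1 / 4 * r), f y ^ 2 ≤ 6 * (8 * C * r ^ (-p)) ^ 2 * (1 / 4 * r) ^ 3 :=
          setIntegral_closedBall_sq_le (by positivity) hM
      _ = 6 * 64 * C ^ 2 / 64 * r ^ (-(2 * p) + 3) := by rw [hvol, hpow]
      _ ≤ 6 * 64 * C ^ 2 * r ^ (-(2 * p) + 3) := by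
          have : 0 ≤ 6 * 64 * C ^ 2 * r ^ (-(2 * p) + 3) := by positivity
          linarith
  refine ⟨?_, fun m => ?_, fun m n => ?_⟩
  · have := step (p := 4) (by norm_num) (by norm_num) fun y hy => (h y (hyfar y hy)).2.1
    norm_num at this ⊢
    exact this
  · have := step (p := 5) (by norm_num) (by norm_num) fun y hy => by
      have h' := (h y (hyfar y hy)).2.2.1 (b m) (hb1 m)
      rwa [show (-4 : ℝ) - 1 = -5 by norm_num] at h'
    norm_num at this ⊢
    exact this
  · have := step (p := 6) (by norm_num) (by norm_num) fun y hy => by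
      have h' := (h y (hyfar y hy)).2.2.2 (b m) (b n) (hb1 m) (hb1 n)
      rwa [show (-4 : ℝ) - 2 = -6 by norm_num] at h'
    norm_num at this ⊢
    exact this

/- ═══════════ Body2 ═══════════ -/

/-! ### Partial derivatives of constant multiples -/

/-- Partial derivatives (first and second, along fixed vectors) of `κ F` on an open set where `F`
is smooth. [folklore] -/
theorem partials_const_mul {F : E3 → ℝ} {U : Set E3} (hU : IsOpen U) (hF : ContDiffOn ℝ ∞ F U)
    (κ : ℝ) {y : E3} (hy : y ∈ U) :
    (∀ v, fderiv ℝ (fun z => κ * F z) y v = κ * fderiv ℝ F y v) ∧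
    (∀ v w, fderiv ℝ (fun z => fderiv ℝ (fun z' => κ * F z') z v) y w =
      κ * fderiv ℝ (fun z => fderiv ℝ F z v) y w) := by
  have hFy : ContDiffAt ℝ ∞ F y := hF.contDiffAt (hU.mem_nhds hy)
  have h1 : ∀ z ∈ U, ∀ v, fderiv ℝ (fun z => κ * F z) z v = κ * fderiv ℝ F z v := by
    intro z hz v
    have hd : DifferentiableAt ℝ F z := (hF.contDiffAt (hU.mem_nhds hz)).differentiableAt (by simp)
    rw [fderiv_const_mul hd]
    rfl
  refine ⟨h1 y hy, fun v w => ?_⟩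
  have hev : (fun z => fderiv ℝ (fun z' => κ * F z') z v) =ᶠ[𝓝 y] fun z => κ * fderiv ℝ F z v :=
    Filter.eventually_of_mem (hU.mem_nhds hy) fun z hz => h1 z hz v
  rw [hev.fderiv_eq]
  have hd : DifferentiableAt ℝ (fun z => fderiv ℝ F z v) y := by
    have h := (hFy.fderiv_right (m := 1) (by norm_cast)).differentiableAt one_ne_zero
    exact h.clm_apply (differentiableAt_const v)
  rw [fderiv_const_mul hd]
  rfl

namespace AFEnd

variable {X : Type} [TopologicalSpace X] [ChartedSpace E3 X] [IsManifold (𝓡 3) ∞ X]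
  (e : AFEnd X) (D : InitialDataSet (𝓡 3) X)

/-! ### The conformal equation in the chart -/

/-- **The linear equation `Δ_h v − (R/8) v = R/8` read in the chart** (Schoen–Yau 1979, (3.1)
with `f = h = R/8`, as in Lemma 3.3): in the scalar-coefficient form of
`MetricCoord.lapAt_eq_secondOrderOp`, for `|y| > R`,
`Σ a_{kl} ∂ₗ∂ₖ v̂ + Σ βₘ ∂ₘ v̂ + (−R∘Φ/8) v̂ = R∘Φ/8`. [cite: SchoenYauPMT1979, §3 (3.1), (3.23)] -/
theorem chartEquation [D.metric.HasLeviCivita] (b : OrthonormalBasis (Fin 3) ℝ E3)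
    {v : X → ℝ} (hv : ContMDiff (𝓡 3) 𝓘(ℝ) ∞ v)
    (hpde : ∀ x, D.metric.dalembertian v x - D.metric.scalarCurvature x / 8 * v x =
      D.metric.scalarCurvature x / 8)
    {y : E3} (hy : e.R < ‖y‖) :
    ∑ k, ∑ l, MetricCoord.ginv (hCoeff e D) b.toBasis y l k
        * fderiv ℝ (fun z => fderiv ℝ (endValue e v) z (b k)) y (b l)
      + ∑ m, (-(2⁻¹ * ∑ k, ∑ l, ∑ j, MetricCoord.ginv (hCoeff e D) b.toBasis y k l
          * MetricCoord.ginv (hCoeff e D) b.toBasis y m j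
          * MetricCoord.koszulCLM (hCoeff e D) y (b k) (b l) (b j))) * fderiv ℝ (endValue e v) y (b m)
      + (-8⁻¹ * scalarCurvatureCoeff e D y) * endValue e v y
      = 8⁻¹ * scalarCurvatureCoeff e D y := by
  have hφ2 : ContMDiffAt (𝓡 3) 𝓘(ℝ, ℝ) 2 v (e.dataChart ⟨y, hy⟩) :=
    (hv.of_le (by norm_cast)).contMDiffAt
  have hsm : ContDiffAt ℝ 2 (endValue e v) y := e.contDiffAt_endValue_of_contMDiffAt hy hφ2
  rw [← MetricCoord.lapAt_eq_secondOrderOp b hsm,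
    ← e.dalembertian_dataChart_eq_lapAt_endValue D ⟨y, hy⟩ hφ2, scalarCurvatureCoeff, dif_pos hy,
    endValue_of_lt e v hy]
  have h := hpde (e.dataChart ⟨y, hy⟩)
  linear_combination h

/-! ### The coefficient hypotheses of the decay bootstrap -/

/-- **The coefficients of the chart equation satisfy the hypotheses of the decay bootstrap**
(`Literature.Analysis.PDE.decay_bootstrap`) on an `O_4(r⁻²)` end: smoothness far out and, with
one constant `K`, `Σ|a − δ| ≤ Kr⁻²`, `Σ|β| ≤ Kr⁻³`, `|c| ≤ Kr⁻⁴` (`c = −R∘Φ/8`), first partials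
`≤ Kr⁻³`, second partials `≤ Kr⁻⁴`. [cite: SchoenYauPMT1979, §1 (1.1), §3 Lemma 3.3] -/
theorem exists_bootstrapCoeff [D.metric.HasLeviCivita] (b : OrthonormalBasis (Fin 3) ℝ E3)
    (hH : IsBigOSmooth 4 (-2) fun y ↦ hCoeff e D y - (innerSL ℝ : E3 →L[ℝ] E3 →L[ℝ] ℝ)) :
    ∃ K r₁ : ℝ, 0 ≤ K ∧ 1 ≤ r₁ ∧ e.R < r₁ ∧
      (∀ k l, ContDiffOn ℝ ∞ (fun y ↦ MetricCoord.ginv (hCoeff e D) b.toBasis y l k)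
        {y : E3 | r₁ < ‖y‖}) ∧
      (∀ m, ContDiffOn ℝ ∞ (fun y ↦ -(2⁻¹ * ∑ k, ∑ l, ∑ j,
          MetricCoord.ginv (hCoeff e D) b.toBasis y k l * MetricCoord.ginv (hCoeff e D) b.toBasis y m j
            * MetricCoord.koszulCLM (hCoeff e D) y (b k) (b l) (b j))) {y : E3 | r₁ < ‖y‖}) ∧
      ContDiffOn ℝ ∞ (scalarCurvatureCoeff e D) {y : E3 | r₁ < ‖y‖} ∧
      ∀ y : E3, r₁ + 1 ≤ ‖y‖ →
      (∑ k, ∑ l, |MetricCoord.ginv (hCoeff e D) b.toBasis y l k - if k = l then 1 else 0|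
          ≤ K * ‖y‖ ^ (-2 : ℝ)) ∧
      (∑ m, |-(2⁻¹ * ∑ k, ∑ l, ∑ j,
          MetricCoord.ginv (hCoeff e D) b.toBasis y k l * MetricCoord.ginv (hCoeff e D) b.toBasis y m j
            * MetricCoord.koszulCLM (hCoeff e D) y (b k) (b l) (b j))| ≤ K * ‖y‖ ^ (-3 : ℝ)) ∧
      |-8⁻¹ * scalarCurvatureCoeff e D y| ≤ K * ‖y‖ ^ (-4 : ℝ) ∧
      (∀ i, (∀ k l, |fderiv ℝ (fun z ↦ MetricCoord.ginv (hCoeff e D) b.toBasis z l k) y (b i)|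
            ≤ K * ‖y‖ ^ (-3 : ℝ)) ∧
        (∀ m, |fderiv ℝ (fun z ↦ -(2⁻¹ * ∑ k, ∑ l, ∑ j,
          MetricCoord.ginv (hCoeff e D) b.toBasis z k l * MetricCoord.ginv (hCoeff e D) b.toBasis z m j
            * MetricCoord.koszulCLM (hCoeff e D) z (b k) (b l) (b j))) y (b i)| ≤ K * ‖y‖ ^ (-3 : ℝ)) ∧
        |fderiv ℝ (fun z ↦ -8⁻¹ * scalarCurvatureCoeff e D z) y (b i)| ≤ K * ‖y‖ ^ (-3 : ℝ)) ∧
      (∀ i j, (∀ k l, |fderiv ℝ (fun z ↦ fderiv ℝ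
            (fun z' ↦ MetricCoord.ginv (hCoeff e D) b.toBasis z' l k) z (b i)) y (b j)|
            ≤ K * ‖y‖ ^ (-4 : ℝ)) ∧
        (∀ m, |fderiv ℝ (fun z ↦ fderiv ℝ (fun z' ↦ -(2⁻¹ * ∑ k, ∑ l, ∑ j,
          MetricCoord.ginv (hCoeff e D) b.toBasis z' k l * MetricCoord.ginv (hCoeff e D) b.toBasis z' m j
            * MetricCoord.koszulCLM (hCoeff e D) z' (b k) (b l) (b j))) z (b i)) y (b j)|
            ≤ K * ‖y‖ ^ (-4 : ℝ)) ∧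
        |fderiv ℝ (fun z ↦ fderiv ℝ (fun z' ↦ -8⁻¹ * scalarCurvatureCoeff e D z') z (b i)) y (b j)|
          ≤ K * ‖y‖ ^ (-4 : ℝ)) := by
  obtain ⟨K, r₁, hK, hr₁, hRr₁, h⟩ := e.exists_chartCoeff_bounds D b hH
  have hU : IsOpen {y : E3 | r₁ < ‖y‖} := isOpen_lt continuous_const continuous_norm
  have hRs : ContDiffOn ℝ ∞ (scalarCurvatureCoeff e D) {y : E3 | r₁ < ‖y‖} := fun y hy =>
    ((h y (le_of_lt hy)).2.2.1).contDiffWithinAt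
  refine ⟨K, r₁, hK, hr₁, hRr₁, fun k l y hy => ((h y (le_of_lt hy)).1.1 k l).contDiffWithinAt,
    fun m y hy => ((h y (le_of_lt hy)).2.1.1 m).contDiffWithinAt, hRs, fun y hy => ?_⟩
  have hy₁ : r₁ ≤ ‖y‖ := by linarith
  have hyU : y ∈ {y : E3 | r₁ < ‖y‖} := by show r₁ < ‖y‖; linarith
  have hy1 : 1 ≤ ‖y‖ := hr₁.trans hy₁
  obtain ⟨⟨-, hA0, hA1, hA2⟩, ⟨-, hB0, hB1, hB2⟩, ⟨-, hC0, hC1, hC2⟩⟩ := h y hy₁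
  have hmono : ∀ {s t : ℝ}, s ≤ t → ‖y‖ ^ s ≤ ‖y‖ ^ t := fun hst =>
    Real.rpow_le_rpow_of_exponent_le hy1 hst
  have hpow : ∀ s : ℝ, 0 ≤ ‖y‖ ^ s := fun s => Real.rpow_nonneg (norm_nonneg _) _
  obtain ⟨hc1, hc2⟩ := partials_const_mul hU hRs (-8⁻¹) hyU
  refine ⟨hA0, hB0, ?_, fun i => ⟨fun k l => hA1 i k l, fun m => ?_, ?_⟩,
    fun i j => ⟨fun k l => hA2 i j k l, fun m => ?_, ?_⟩⟩
  · rw [abs_mul, show |(-8⁻¹ : ℝ)| = 8⁻¹ by norm_num]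
    have := hC0
    nlinarith [hpow (-4), hK]
  · exact (hB1 i m).trans (mul_le_mul_of_nonneg_left (hmono (by norm_num)) hK)
  · rw [hc1, abs_mul, show |(-8⁻¹ : ℝ)| = 8⁻¹ by norm_num]
    have h5 := (hC1 i).trans (mul_le_mul_of_nonneg_left (hmono (show (-5:ℝ) ≤ -3 by norm_num)) hK)
    nlinarith [hpow (-3), hK, abs_nonneg (fderiv ℝ (scalarCurvatureCoeff e D) y (b i))]
  · exact (hB2 i j m).trans (mul_le_mul_of_nonneg_left (hmono (by norm_num)) hK)
  · rw [hc2, abs_mul, show |(-8⁻¹ : ℝ)| = 8⁻¹ by norm_num]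
    have h6 := (hC2 i j).trans (mul_le_mul_of_nonneg_left (hmono (show (-6:ℝ) ≤ -4 by norm_num)) hK)
    nlinarith [hpow (-4), hK,
      abs_nonneg (fderiv ℝ (fun z => fderiv ℝ (scalarCurvatureCoeff e D) z (b i)) y (b j))]

end AFEnd

/- ═══════════ Body3 ═══════════ -/

/-! ### Ball `L²` bounds from pointwise decay -/

/-- `∫_{B̄(x,|x|/4)} f² ≤ 384 C² |x|^{3−2p}` if `|f(y)| ≤ C|y|^{−p}` for `|y| ≥ R` (`0 ≤ p ≤ 6`) and
`|x| ≥ max(4R/3, 1)`. [folklore] -/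
theorem setIntegral_quarterBall_sq_le {f : E3 → ℝ} {C p R : ℝ} (hC : 0 ≤ C) (hp0 : 0 ≤ p)
    (hp6 : p ≤ 6) (hf : ∀ y : E3, R ≤ ‖y‖ → |f y| ≤ C * ‖y‖ ^ (-p)) {x : E3}
    (hx : max (4 / 3 * R) 1 ≤ ‖x‖) :
    ∫ y in closedBall x (1 / 4 * ‖x‖), f y ^ 2 ≤ 6 * 64 * C ^ 2 * ‖x‖ ^ (-(2 * p) + 3) := by
  obtain ⟨r, hr⟩ : ∃ r : ℝ, r = ‖x‖ := ⟨_, rfl⟩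
  rw [← hr] at hx ⊢
  have hr1 : 1 ≤ r := le_trans (le_max_right _ _) hx
  have hr0 : 0 < r := by linarith
  have hx0 : 0 < ‖x‖ := by rwa [← hr]
  have hquarter : (1 / 4 : ℝ) ≤ 1 / 4 := le_rfl
  have hyfar : ∀ y ∈ closedBall x (1 / 4 * r), R ≤ ‖y‖ := fun y hy => by
    have h34 : 3 / 4 * ‖x‖ ≤ ‖y‖ := norm_ge_of_mem_closedBall hquarter (by rwa [← hr])
    have : 4 / 3 * R ≤ r := le_trans (le_max_left _ _) hx
    rw [hr] at this
    linarith
  have h43 : (4 / 3 : ℝ) ^ p ≤ 8 :=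
    calc (4 / 3 : ℝ) ^ p ≤ (4 / 3 : ℝ) ^ (6 : ℝ) := Real.rpow_le_rpow_of_exponent_le (by norm_num) hp6
      _ ≤ 8 := by norm_num
  have hM : ∀ y ∈ closedBall x (1 / 4 * r), |f y| ≤ 8 * C * r ^ (-p) := fun y hy => by
    have hyp : ‖y‖ ^ (-p) ≤ (4 / 3) ^ p * r ^ (-p) := by
      rw [hr]; exact rpow_neg_le_of_mem_closedBall hquarter hx0 hp0 (by rwa [← hr])
    calc |f y| ≤ C * ‖y‖ ^ (-p) := hf y (hyfar y hy)
      _ ≤ C * ((4 / 3) ^ p * r ^ (-p)) := mul_le_mul_of_nonneg_left hyp hC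
      _ ≤ C * (8 * r ^ (-p)) := mul_le_mul_of_nonneg_left
          (mul_le_mul_of_nonneg_right h43 (Real.rpow_nonneg hr0.le _)) hC
      _ = 8 * C * r ^ (-p) := by ring
  have hpow : r ^ (-p) * r ^ (-p) * r ^ 3 = r ^ (-(2 * p) + 3) := by
    rw [← Real.rpow_add hr0, ← Real.rpow_natCast, ← Real.rpow_add hr0]
    congr 1; push_cast; ring
  calc ∫ y in closedBall x (1 / 4 * r), f y ^ 2 ≤ 6 * (8 * C * r ^ (-p)) ^ 2 * (1 / 4 * r) ^ 3 :=
        setIntegral_closedBall_sq_le (by positivity) hM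
    _ = 6 * 64 * C ^ 2 / 64 * (r ^ (-p) * r ^ (-p) * r ^ 3) := by ring
    _ = 6 * 64 * C ^ 2 / 64 * r ^ (-(2 * p) + 3) := by rw [hpow]
    _ ≤ 6 * 64 * C ^ 2 * r ^ (-(2 * p) + 3) := by
        have : 0 ≤ 6 * 64 * C ^ 2 * r ^ (-(2 * p) + 3) := by positivity
        linarith

/-! ### The flat Laplacian of a solution, compared with the source -/

/-- **`Δu − g` for a solution of `Σ a∂∂u + Σ β∂u + cu = g`** with `Σ|a − δ| ≤ Kr⁻²`,
`Σ|β| ≤ Kr⁻³`, `|c| ≤ Kr⁻⁴` and `|u| ≤ Cr^s`, `|∂u| ≤ Cr^{s−1}`, `|∂²u| ≤ Cr^{s−2}` at the point: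
`|Δu − g| ≤ 3KC r^{s−4}` (`Δu = Σₖ ∂ₖ∂ₖu`, and `Σ a∂∂u = Δu + Σ (a−δ)∂∂u`). This is how the flat
Laplacian of Schoen–Yau's `v` is controlled from (3.9) before the Newtonian potential is expanded
((3.12)–(3.15)). [cite: SchoenYauPMT1979, Lemma 3.2, (3.9)–(3.15)] -/
theorem abs_laplacian_sub_source_le (b : OrthonormalBasis (Fin 3) ℝ E3) {u g : E3 → ℝ}
    {a : Fin 3 → Fin 3 → E3 → ℝ} {β : Fin 3 → E3 → ℝ} {c : E3 → ℝ} {y : E3} {K C s : ℝ}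
    (hC : 0 ≤ C) (hy : 0 < ‖y‖) (hu : ContDiffAt ℝ 2 u y)
    (heq : ∑ k, ∑ l, a k l y * fderiv ℝ (fun z' => fderiv ℝ u z' (b k)) y (b l)
        + ∑ k, β k y * fderiv ℝ u y (b k) + c y * u y = g y)
    (ha : ∑ k, ∑ l, |a k l y - if k = l then 1 else 0| ≤ K * ‖y‖ ^ (-2 : ℝ))
    (hβ : ∑ k, |β k y| ≤ K * ‖y‖ ^ (-3 : ℝ)) (hc : |c y| ≤ K * ‖y‖ ^ (-4 : ℝ))
    (h0 : |u y| ≤ C * ‖y‖ ^ s) (h1 : ∀ m, |fderiv ℝ u y (b m)| ≤ C * ‖y‖ ^ (s - 1))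
    (h2 : ∀ m n, |fderiv ℝ (fun z => fderiv ℝ u z (b m)) y (b n)| ≤ C * ‖y‖ ^ (s - 2)) :
    |(Δ u) y - g y| ≤ 3 * K * C * ‖y‖ ^ (s - 4) := by
  have hK : 0 ≤ K := by
    have h := (abs_nonneg _).trans hc
    have hp : 0 < ‖y‖ ^ (-4 : ℝ) := Real.rpow_pos_of_pos hy _
    by_contra hneg
    have : K * ‖y‖ ^ (-4 : ℝ) < 0 := mul_neg_of_neg_of_pos (lt_of_not_ge hneg) hp
    linarith
  have hpow : ∀ t : ℝ, 0 ≤ ‖y‖ ^ t := fun t => Real.rpow_nonneg (norm_nonneg _) _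
  have hmul : ∀ t t' : ℝ, ‖y‖ ^ t * ‖y‖ ^ t' = ‖y‖ ^ (t + t') := fun t t' => (Real.rpow_add hy _ _).symm
  -- the Laplacian and the `δ` part of the second-order term
  rw [laplacian_eq_sum_of_contDiffAt b hu]
  have hδ : ∑ k, ∑ l, (if k = l then (1 : ℝ) else 0) * fderiv ℝ (fun z' => fderiv ℝ u z' (b k)) y (b l)
      = ∑ k, fderiv ℝ (fun z => fderiv ℝ u z (b k)) y (b k) :=
    Finset.sum_congr rfl fun k _ => by simp [Finset.sum_ite_eq]
  have hsplit : ∑ k, fderiv ℝ (fun z => fderiv ℝ u z (b k)) y (b k) - g y =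
      -(∑ k, ∑ l, (a k l y - if k = l then 1 else 0) * fderiv ℝ (fun z' => fderiv ℝ u z' (b k)) y (b l)
        + ∑ k, β k y * fderiv ℝ u y (b k) + c y * u y) := by
    rw [← hδ, ← heq]
    simp only [sub_mul, Finset.sum_sub_distrib]
    ring
  rw [hsplit, abs_neg]
  -- the three bounds
  have hA : |∑ k, ∑ l, (a k l y - if k = l then 1 else 0) * fderiv ℝ (fun z' => fderiv ℝ u z' (b k)) y (b l)|
      ≤ K * ‖y‖ ^ (-2 : ℝ) * (C * ‖y‖ ^ (s - 2)) := by
    calc |∑ k, ∑ l, (a k l y - if k = l then 1 else 0) * fderiv ℝ (fun z' => fderiv ℝ u z' (b k)) y (b l)|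
        ≤ ∑ k, ∑ l, |a k l y - if k = l then 1 else 0| * (C * ‖y‖ ^ (s - 2)) := by
          refine (Finset.abs_sum_le_sum_abs _ _).trans (Finset.sum_le_sum fun k _ => ?_)
          refine (Finset.abs_sum_le_sum_abs _ _).trans (Finset.sum_le_sum fun l _ => ?_)
          rw [abs_mul]
          exact mul_le_mul_of_nonneg_left (h2 k l) (abs_nonneg _)
      _ = (∑ k, ∑ l, |a k l y - if k = l then 1 else 0|) * (C * ‖y‖ ^ (s - 2)) := by
          rw [Finset.sum_mul]; exact Finset.sum_congr rfl fun k _ => by rw [Finset.sum_mul]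
      _ ≤ K * ‖y‖ ^ (-2 : ℝ) * (C * ‖y‖ ^ (s - 2)) :=
          mul_le_mul_of_nonneg_right ha (mul_nonneg hC (hpow _))
  have hB : |∑ k, β k y * fderiv ℝ u y (b k)| ≤ K * ‖y‖ ^ (-3 : ℝ) * (C * ‖y‖ ^ (s - 1)) := by
    calc |∑ k, β k y * fderiv ℝ u y (b k)| ≤ ∑ k, |β k y| * (C * ‖y‖ ^ (s - 1)) := by
          refine (Finset.abs_sum_le_sum_abs _ _).trans (Finset.sum_le_sum fun k _ => ?_)
          rw [abs_mul]
          exact mul_le_mul_of_nonneg_left (h1 k) (abs_nonneg _)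
      _ = (∑ k, |β k y|) * (C * ‖y‖ ^ (s - 1)) := by rw [Finset.sum_mul]
      _ ≤ K * ‖y‖ ^ (-3 : ℝ) * (C * ‖y‖ ^ (s - 1)) :=
          mul_le_mul_of_nonneg_right hβ (mul_nonneg hC (hpow _))
  have hCc : |c y * u y| ≤ K * ‖y‖ ^ (-4 : ℝ) * (C * ‖y‖ ^ s) := by
    rw [abs_mul]
    exact mul_le_mul hc h0 (abs_nonneg _) (mul_nonneg hK (hpow _))
  have e1 : K * ‖y‖ ^ (-2 : ℝ) * (C * ‖y‖ ^ (s - 2)) = K * C * ‖y‖ ^ (s - 4) := by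
    rw [show K * ‖y‖ ^ (-2 : ℝ) * (C * ‖y‖ ^ (s - 2)) = K * C * (‖y‖ ^ (-2 : ℝ) * ‖y‖ ^ (s - 2)) by ring,
      hmul]; ring_nf
  have e2 : K * ‖y‖ ^ (-3 : ℝ) * (C * ‖y‖ ^ (s - 1)) = K * C * ‖y‖ ^ (s - 4) := by
    rw [show K * ‖y‖ ^ (-3 : ℝ) * (C * ‖y‖ ^ (s - 1)) = K * C * (‖y‖ ^ (-3 : ℝ) * ‖y‖ ^ (s - 1)) by ring,
      hmul]; ring_nf
  have e3 : K * ‖y‖ ^ (-4 : ℝ) * (C * ‖y‖ ^ s) = K * C * ‖y‖ ^ (s - 4) := by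
    rw [show K * ‖y‖ ^ (-4 : ℝ) * (C * ‖y‖ ^ s) = K * C * (‖y‖ ^ (-4 : ℝ) * ‖y‖ ^ s) by ring,
      hmul]; ring_nf
  calc |∑ k, ∑ l, (a k l y - if k = l then 1 else 0) * fderiv ℝ (fun z' => fderiv ℝ u z' (b k)) y (b l)
        + ∑ k, β k y * fderiv ℝ u y (b k) + c y * u y|
      ≤ |∑ k, ∑ l, (a k l y - if k = l then 1 else 0) * fderiv ℝ (fun z' => fderiv ℝ u z' (b k)) y (b l)|
        + |∑ k, β k y * fderiv ℝ u y (b k)| + |c y * u y| := abs_add_three _ _ _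
    _ ≤ K * ‖y‖ ^ (-2 : ℝ) * (C * ‖y‖ ^ (s - 2)) + K * ‖y‖ ^ (-3 : ℝ) * (C * ‖y‖ ^ (s - 1))
        + K * ‖y‖ ^ (-4 : ℝ) * (C * ‖y‖ ^ s) := add_le_add (add_le_add hA hB) hCc
    _ = 3 * K * C * ‖y‖ ^ (s - 4) := by rw [e1, e2, e3]; ring

/- ═══════════ Body4 ═══════════ -/

namespace AFEnd

variable {X : Type} [TopologicalSpace X] [ChartedSpace E3 X] [IsManifold (𝓡 3) ∞ X]
  (e : AFEnd X) (D : InitialDataSet (𝓡 3) X)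

set_option maxHeartbeats 800000 in
/-- **One run of the decay bootstrap for the chart equation.** If `u` is smooth far out and
solves `Σ a_{kl}∂ₗ∂ₖu + Σ βₘ∂ₘu − (R∘Φ/8) u = g` there (the coefficients of `Δ_h` on an `O_4(r⁻²)`
end), with `g ∈ O_2(r⁻⁴)` and `∫_{B̄(x,|x|/4)} u² ≤ K₀|x|^q` (`q ≥ −1`), then
`|u| ≤ C r^{(q−3)/2}`, `|∂u| ≤ C r^{(q−5)/2}`, `|∂²u| ≤ C r^{(q−7)/2}` far out
(`Literature.Analysis.PDE.decay_bootstrap` with `θ = 1/4`). Schoen–Yau obtain these pointwise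
derivative estimates from (3.9) by Schauder theory ("standard interior estimates", p. 67).
[cite: SchoenYauPMT1979, Lemma 3.2, (3.9)–(3.11) (p. 67)] -/
theorem bootstrap_stage [D.metric.HasLeviCivita] (b : OrthonormalBasis (Fin 3) ℝ E3)
    (hH : IsBigOSmooth 4 (-2) fun y ↦ hCoeff e D y - (innerSL ℝ : E3 →L[ℝ] E3 →L[ℝ] ℝ))
    {u g : E3 → ℝ} {q ρ : ℝ} (hq : -1 ≤ q)
    (hu : ContDiffOn ℝ ∞ u {y : E3 | ρ < ‖y‖}) (hg : IsBigOSmooth 2 (-4) g)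
    (heq : ∀ y : E3, ρ < ‖y‖ →
      ∑ k, ∑ l, MetricCoord.ginv (hCoeff e D) b.toBasis y l k
          * fderiv ℝ (fun z' => fderiv ℝ u z' (b k)) y (b l)
        + ∑ m, (-(2⁻¹ * ∑ k, ∑ l, ∑ j, MetricCoord.ginv (hCoeff e D) b.toBasis y k l
            * MetricCoord.ginv (hCoeff e D) b.toBasis y m j
            * MetricCoord.koszulCLM (hCoeff e D) y (b k) (b l) (b j))) * fderiv ℝ u y (b m)
        + (-8⁻¹ * scalarCurvatureCoeff e D y) * u y = g y)
    {K₀ r₀ : ℝ} (hK₀ : 0 ≤ K₀)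
    (hI : ∀ x : E3, r₀ ≤ ‖x‖ → ∫ y in closedBall x (1 / 4 * ‖x‖), u y ^ 2 ≤ K₀ * ‖x‖ ^ q) :
    ∃ C r₂ : ℝ, 0 ≤ C ∧ ∀ x : E3, r₂ ≤ ‖x‖ →
      |u x| ≤ C * ‖x‖ ^ ((q - 3) / 2) ∧
      (∀ m, |fderiv ℝ u x (b m)| ≤ C * ‖x‖ ^ ((q - 5) / 2)) ∧
      (∀ m n, |fderiv ℝ (fun z => fderiv ℝ u z (b m)) x (b n)| ≤ C * ‖x‖ ^ ((q - 7) / 2)) := by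
  obtain ⟨K₁, r₁, hK₁, hr₁1, hRr₁, has, hβs, hRs, hcoef⟩ := e.exists_bootstrapCoeff D b hH
  obtain ⟨K₂, r₂, hK₂, hG⟩ := exists_sourceBounds_of_isBigOSmooth b hg
  obtain ⟨Rg, hgs⟩ := hg.1
  -- the common far region
  set R₀ : ℝ := max (max ρ r₁) Rg with hR₀
  have hρR : ρ ≤ R₀ := (le_max_left _ _).trans (le_max_left _ _)
  have hr₁R : r₁ ≤ R₀ := (le_max_right _ _).trans (le_max_left _ _)
  have hRgR : Rg ≤ R₀ := le_max_right _ _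
  have hsub : ∀ {t : ℝ}, t ≤ R₀ → {y : E3 | R₀ < ‖y‖} ⊆ {y : E3 | t < ‖y‖} := fun ht y hy =>
    lt_of_le_of_lt ht hy
  have hu' : ContDiffOn ℝ ∞ u {y : E3 | R₀ < ‖y‖} := hu.mono (hsub hρR)
  have hg' : ContDiffOn ℝ ∞ g {y : E3 | R₀ < ‖y‖} := hgs.mono (hsub hRgR)
  have has' : ∀ k l, ContDiffOn ℝ ∞ (fun y ↦ MetricCoord.ginv (hCoeff e D) b.toBasis y l k)
      {y : E3 | R₀ < ‖y‖} := fun k l => (has k l).mono (hsub hr₁R)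
  have hβs' : ∀ m, ContDiffOn ℝ ∞ (fun y ↦ -(2⁻¹ * ∑ k, ∑ l, ∑ j,
      MetricCoord.ginv (hCoeff e D) b.toBasis y k l * MetricCoord.ginv (hCoeff e D) b.toBasis y m j
        * MetricCoord.koszulCLM (hCoeff e D) y (b k) (b l) (b j))) {y : E3 | R₀ < ‖y‖} :=
    fun m => (hβs m).mono (hsub hr₁R)
  have hcs' : ContDiffOn ℝ ∞ (fun y ↦ -8⁻¹ * scalarCurvatureCoeff e D y) {y : E3 | R₀ < ‖y‖} :=
    contDiffOn_const.mul (hRs.mono (hsub hr₁R))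
  have heq' : ∀ z ∈ {y : E3 | R₀ < ‖y‖},
      ∑ k, ∑ l, MetricCoord.ginv (hCoeff e D) b.toBasis z l k
          * fderiv ℝ (fun z' => fderiv ℝ u z' (b k)) z (b l)
        + ∑ m, (-(2⁻¹ * ∑ k, ∑ l, ∑ j, MetricCoord.ginv (hCoeff e D) b.toBasis z k l
            * MetricCoord.ginv (hCoeff e D) b.toBasis z m j
            * MetricCoord.koszulCLM (hCoeff e D) z (b k) (b l) (b j))) * fderiv ℝ u z (b m)
        + (-8⁻¹ * scalarCurvatureCoeff e D z) * u z = g z := fun z hz => heq z (lt_of_le_of_lt hρR hz)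
  -- one constant and one radius
  set K : ℝ := max K₁ K₂ with hKdef
  have hK : 0 ≤ K := hK₁.trans (le_max_left _ _)
  set r' : ℝ := max (r₁ + 1) (max r₂ r₀) with hr'
  have hpow : ∀ (y : E3) (s : ℝ), 0 ≤ ‖y‖ ^ s := fun y s => Real.rpow_nonneg (norm_nonneg _) _
  have hle₁ : ∀ {t : ℝ} {y : E3} {s : ℝ}, t ≤ K₁ * ‖y‖ ^ s → t ≤ K * ‖y‖ ^ s := fun h =>
    h.trans (mul_le_mul_of_nonneg_right (le_max_left _ _) (hpow _ _))
  have hle₂ : ∀ {t : ℝ} {y : E3} {s : ℝ}, t ≤ K₂ * ‖y‖ ^ s → t ≤ K * ‖y‖ ^ s := fun h =>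
    h.trans (mul_le_mul_of_nonneg_right (le_max_right _ _) (hpow _ _))
  have hcoef' : ∀ y : E3, r' ≤ ‖y‖ →
      (∑ k, ∑ l, |MetricCoord.ginv (hCoeff e D) b.toBasis y l k - if k = l then 1 else 0|
          ≤ K * ‖y‖ ^ (-2 : ℝ)) ∧
      (∑ m, |-(2⁻¹ * ∑ k, ∑ l, ∑ j,
          MetricCoord.ginv (hCoeff e D) b.toBasis y k l * MetricCoord.ginv (hCoeff e D) b.toBasis y m j
            * MetricCoord.koszulCLM (hCoeff e D) y (b k) (b l) (b j))| ≤ K * ‖y‖ ^ (-3 : ℝ)) ∧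
      |-8⁻¹ * scalarCurvatureCoeff e D y| ≤ K * ‖y‖ ^ (-4 : ℝ) ∧
      (∀ i, (∀ k l, |fderiv ℝ (fun z ↦ MetricCoord.ginv (hCoeff e D) b.toBasis z l k) y (b i)|
            ≤ K * ‖y‖ ^ (-3 : ℝ)) ∧
        (∀ m, |fderiv ℝ (fun z ↦ -(2⁻¹ * ∑ k, ∑ l, ∑ j,
          MetricCoord.ginv (hCoeff e D) b.toBasis z k l * MetricCoord.ginv (hCoeff e D) b.toBasis z m j
            * MetricCoord.koszulCLM (hCoeff e D) z (b k) (b l) (b j))) y (b i)| ≤ K * ‖y‖ ^ (-3 : ℝ)) ∧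
        |fderiv ℝ (fun z ↦ -8⁻¹ * scalarCurvatureCoeff e D z) y (b i)| ≤ K * ‖y‖ ^ (-3 : ℝ)) ∧
      (∀ i j, (∀ k l, |fderiv ℝ (fun z ↦ fderiv ℝ
            (fun z' ↦ MetricCoord.ginv (hCoeff e D) b.toBasis z' l k) z (b i)) y (b j)|
            ≤ K * ‖y‖ ^ (-4 : ℝ)) ∧
        (∀ m, |fderiv ℝ (fun z ↦ fderiv ℝ (fun z' ↦ -(2⁻¹ * ∑ k, ∑ l, ∑ j,
          MetricCoord.ginv (hCoeff e D) b.toBasis z' k l * MetricCoord.ginv (hCoeff e D) b.toBasis z' m j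
            * MetricCoord.koszulCLM (hCoeff e D) z' (b k) (b l) (b j))) z (b i)) y (b j)|
            ≤ K * ‖y‖ ^ (-4 : ℝ)) ∧
        |fderiv ℝ (fun z ↦ fderiv ℝ (fun z' ↦ -8⁻¹ * scalarCurvatureCoeff e D z') z (b i)) y (b j)|
          ≤ K * ‖y‖ ^ (-4 : ℝ)) := by
    intro y hy
    have hy' : r₁ + 1 ≤ ‖y‖ := (le_max_left _ _).trans hy
    obtain ⟨h1, h2, h3, h4, h5⟩ := hcoef y hy'
    refine ⟨hle₁ h1, hle₁ h2, hle₁ h3, fun i => ?_, fun i j => ?_⟩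
    · obtain ⟨h4a, h4b, h4c⟩ := h4 i
      exact ⟨fun k l => hle₁ (h4a k l), fun m => hle₁ (h4b m), hle₁ h4c⟩
    · obtain ⟨h5a, h5b, h5c⟩ := h5 i j
      exact ⟨fun k l => hle₁ (h5a k l), fun m => hle₁ (h5b m), hle₁ h5c⟩
  have hG' : ∀ x : E3, r' ≤ ‖x‖ →
      (∫ y in closedBall x (1 / 4 * ‖x‖), g y ^ 2) ≤ K * ‖x‖ ^ (-5 : ℝ) ∧
      (∀ m, (∫ y in closedBall x (1 / 4 * ‖x‖), (fderiv ℝ g y (b m)) ^ 2) ≤ K * ‖x‖ ^ (-7 : ℝ)) ∧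
      (∀ m n, (∫ y in closedBall x (1 / 4 * ‖x‖),
          (fderiv ℝ (fun z => fderiv ℝ g z (b m)) y (b n)) ^ 2) ≤ K * ‖x‖ ^ (-9 : ℝ)) := by
    intro x hx
    have hx' : r₂ ≤ ‖x‖ := le_trans (le_trans (le_max_left _ _) (le_max_right _ _)) hx
    obtain ⟨h1, h2, h3⟩ := hG x hx'
    exact ⟨hle₂ h1, fun m => hle₂ (h2 m), fun m n => hle₂ (h3 m n)⟩
  have hI' : ∀ x : E3, r' ≤ ‖x‖ → ∫ y in closedBall x (1 / 4 * ‖x‖), u y ^ 2 ≤ K₀ * ‖x‖ ^ q :=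
    fun x hx => hI x (le_trans (le_trans (le_max_right _ _) (le_max_right _ _)) hx)
  -- the bootstrap
  obtain ⟨C, r₃, hC⟩ := decay_bootstrap b (R₀ := R₀) (θ := 1 / 4) (by norm_num) le_rfl hq hK hK₀
    hu' hg' has' hβs' hcs' heq' hcoef' hG' hI'
  refine ⟨Real.sqrt C, max r₃ 1, Real.sqrt_nonneg _, fun x hx => ?_⟩
  have hx₃ : r₃ ≤ ‖x‖ := (le_max_left _ _).trans hx
  have hx0 : 0 < ‖x‖ := lt_of_lt_of_le one_pos ((le_max_right _ _).trans hx)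
  obtain ⟨h0, h1, h2, -, -⟩ := hC x hx₃
  refine ⟨?_, fun m => ?_, fun m n => ?_⟩
  · have := abs_le_sqrt_mul_rpow_half hx0 h0
    rwa [show (q - 3) / 2 = (q - 3) / 2 from rfl] at this
  · exact abs_le_sqrt_mul_rpow_half hx0 (h1 m)
  · exact abs_le_sqrt_mul_rpow_half hx0 (h2 m n)

end AFEnd

/- ═══════════ Body5 ═══════════ -/

/-! ### Smooth extension of a far-out function by a cutoff -/

/-- **Cutting off near infinity**: a function smooth on `{|y| > ρ}` (`ρ ≥ 0`) agrees on
`{|y| ≥ 2ρ + 2}` with a function `W ∈ C^∞(ℝ³)` vanishing on `{|y| ≤ ρ + 1}` and dominated by it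
everywhere (`W = (1 − bump) u`). [folklore] -/
theorem exists_smooth_cutoff_mul {u : E3 → ℝ} {ρ : ℝ} (hρ : 0 ≤ ρ)
    (hu : ContDiffOn ℝ ∞ u {y : E3 | ρ < ‖y‖}) :
    ∃ W : E3 → ℝ, ContDiff ℝ ∞ W ∧ (∀ y : E3, 2 * ρ + 2 < ‖y‖ → W =ᶠ[𝓝 y] u) ∧
      (∀ y : E3, |W y| ≤ |u y|) ∧ (∀ y : E3, ‖y‖ ≤ ρ + 1 → W y = 0) := by
  let f : ContDiffBump (0 : E3) := ⟨ρ + 1, 2 * ρ + 2, by linarith, by linarith⟩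
  have hf1 : ∀ y : E3, ‖y‖ ≤ ρ + 1 → f y = 1 := fun y hy =>
    f.one_of_mem_closedBall (by simpa using hy)
  have hf0 : ∀ y : E3, 2 * ρ + 2 ≤ ‖y‖ → f y = 0 := fun y hy =>
    f.zero_of_le_dist (by simpa using hy)
  have hU : IsOpen {y : E3 | ρ < ‖y‖} := isOpen_lt continuous_const continuous_norm
  refine ⟨fun y => (1 - f y) * u y, ?_, fun y hy => ?_, fun y => ?_, fun y hy => ?_⟩
  · refine contDiff_iff_contDiffAt.2 fun y => ?_
    rcases lt_or_ge ρ ‖y‖ with hy | hy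
    · exact (contDiffAt_const.sub f.contDiff.contDiffAt).mul (hu.contDiffAt (hU.mem_nhds hy))
    · have hev : (fun z : E3 => (1 - f z) * u z) =ᶠ[𝓝 y] fun _ => 0 := by
        filter_upwards [Metric.ball_mem_nhds y one_pos] with z hz
        rw [mem_ball, dist_eq_norm] at hz
        have hz' : ‖z‖ ≤ ρ + 1 := by
          have := norm_le_of_mem_closedBall (show z ∈ closedBall y 1 from by
            rw [mem_closedBall, dist_eq_norm]; exact hz.le)
          linarith [norm_sub_norm_le z y, this]
        rw [hf1 z hz', sub_self, zero_mul]
      exact (contDiffAt_const (c := (0 : ℝ))).congr_of_eventuallyEq hev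
  · filter_upwards [(isOpen_lt continuous_const continuous_norm).mem_nhds hy] with z hz
    rw [hf0 z (le_of_lt hz), sub_zero, one_mul]
  · rw [abs_mul]
    have h0 := f.nonneg (x := y)
    have h1 := f.le_one (x := y)
    have : |1 - f y| ≤ 1 := by rw [abs_le]; constructor <;> linarith
    exact (mul_le_mul_of_nonneg_right this (abs_nonneg _)).trans (by rw [one_mul])
  · show (1 - f y) * u y = 0
    rw [hf1 y hy, sub_self, zero_mul]

/-! ### `O(1/r)` from quartic decay of the flat Laplacian -/

/-- **Functions tending to zero with `Δu = O(r⁻⁴)` are `O(r⁻¹)`**: if `u` is smooth on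
`{|y| > ρ}`, `|u| ≤ C r^{−s}` (`s > 0`) and `|Δu| ≤ K r⁻⁴` far out, then `|u(x)| ≤ C'|x|⁻¹` far
out — Green's representation of a cut-off of `u`
(`Literature.Analysis.Potential.isBigO_inv_norm_of_laplacian_decay`). This is Schoen–Yau's
`|v| ≤ k₈/(1 + r)`, (3.9), obtained there from the Green's function bound (3.8).
[cite: SchoenYauPMT1979, Lemma 3.2, (3.6)–(3.9)] -/
theorem exists_inv_norm_bound_of_laplacian_decay {u : E3 → ℝ} {ρ C K R s : ℝ} (hρ : 0 ≤ ρ)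
    (hs : 0 < s) (hu : ContDiffOn ℝ ∞ u {y : E3 | ρ < ‖y‖})
    (hdecay : ∀ y : E3, R ≤ ‖y‖ → |u y| ≤ C * ‖y‖ ^ (-s))
    (hΔ : ∀ y : E3, R ≤ ‖y‖ → |(Δ u) y| ≤ K * ‖y‖ ^ (-4 : ℝ)) :
    ∃ C' R' : ℝ, ∀ x : E3, R' ≤ ‖x‖ → |u x| ≤ C' * ‖x‖⁻¹ := by
  obtain ⟨W, hW, hWu, hWle, -⟩ := exists_smooth_cutoff_mul hρ hu
  have hW2 : ContDiff ℝ 2 W := hW.of_le (by norm_cast)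
  -- `W → 0` at infinity
  have hW0 : Tendsto W (cobounded E3) (𝓝 0) := by
    rw [tendsto_zero_iff_norm_tendsto_zero]
    have hlim : Tendsto (fun y : E3 => C * ‖y‖ ^ (-s)) (cobounded E3) (𝓝 0) := by
      have h := ((tendsto_rpow_neg_atTop hs).comp (tendsto_norm_cobounded_atTop (E := E3))).const_mul C
      rw [mul_zero] at h
      exact h
    refine squeeze_zero' (Eventually.of_forall fun y => norm_nonneg _) ?_ hlim
    filter_upwards [eventually_cobounded_lt_norm (E := E3) R] with y hy
    rw [Real.norm_eq_abs]
    exact (hWle y).trans (hdecay y hy.le)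
  -- `|ΔW| ≤ K' (1 + r)⁻⁴`
  set Rf : ℝ := max (max R (2 * ρ + 3)) 1 with hRf
  have hΔc : Continuous (Δ W) := Literature.Analysis.FluidPDE.continuous_laplacian hW2
  obtain ⟨B, hB⟩ := (isCompact_closedBall (0 : E3) Rf).exists_bound_of_continuousOn hΔc.continuousOn
  have hB0 : 0 ≤ B := (norm_nonneg _).trans (hB 0 (mem_closedBall_self (by positivity)))
  have hK0 : 0 ≤ K := by
    obtain ⟨y, hy⟩ : ∃ y : E3, Rf ≤ ‖y‖ := by
      obtain ⟨y, hy⟩ := NormedSpace.exists_lt_norm ℝ E3 Rf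
      exact ⟨y, hy.le⟩
    have hyR : R ≤ ‖y‖ := le_trans (le_trans (le_max_left _ _) (le_max_left _ _)) hy
    have h := (abs_nonneg _).trans (hΔ y hyR)
    have hy0 : 0 < ‖y‖ := lt_of_lt_of_le one_pos ((le_max_right _ _).trans hy)
    have hp : 0 < ‖y‖ ^ (-4 : ℝ) := Real.rpow_pos_of_pos hy0 _
    by_contra hneg
    have : K * ‖y‖ ^ (-4 : ℝ) < 0 := mul_neg_of_neg_of_pos (lt_of_not_ge hneg) hp
    linarith
  have hΔW : ∀ y : E3, |(Δ W) y| ≤ (16 * K + B * (1 + Rf) ^ 4) * (1 + ‖y‖) ^ (-4 : ℝ) := by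
    intro y
    have h1y : 0 < 1 + ‖y‖ := by positivity
    have hpos : 0 < (1 + ‖y‖) ^ (-4 : ℝ) := Real.rpow_pos_of_pos h1y _
    rcases le_or_gt Rf ‖y‖ with hy | hy
    · -- far: `ΔW = Δu`
      have hy2 : 2 * ρ + 2 < ‖y‖ := by
        have := le_trans (le_trans (le_max_right _ _) (le_max_left _ _)) hy; linarith
      have hyR : R ≤ ‖y‖ := le_trans (le_trans (le_max_left _ _) (le_max_left _ _)) hy
      have hy1 : 1 ≤ ‖y‖ := le_trans (le_max_right _ _) hy
      have hΔeq : (Δ W) y = (Δ u) y := (laplacian_congr_nhds (hWu y hy2)).self_of_nhds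
      rw [hΔeq]
      have hcmp : ‖y‖ ^ (-4 : ℝ) ≤ 16 * (1 + ‖y‖) ^ (-4 : ℝ) := by
        have h2 : (2 * ‖y‖) ^ (-4 : ℝ) ≤ (1 + ‖y‖) ^ (-4 : ℝ) :=
          Real.rpow_le_rpow_of_nonpos h1y (by linarith) (by norm_num)
        have h16 : (2 : ℝ) ^ (-4 : ℝ) = 16⁻¹ := by
          rw [Real.rpow_neg (by norm_num : (0 : ℝ) ≤ 2), show (4 : ℝ) = ((4 : ℕ) : ℝ) by norm_num,
            Real.rpow_natCast]
          norm_num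
        have h3 : (2 * ‖y‖) ^ (-4 : ℝ) = 16⁻¹ * ‖y‖ ^ (-4 : ℝ) := by
          rw [Real.mul_rpow (by norm_num) (norm_nonneg _), h16]
        rw [h3] at h2
        linarith
      calc |(Δ u) y| ≤ K * ‖y‖ ^ (-4 : ℝ) := hΔ y hyR
        _ ≤ K * (16 * (1 + ‖y‖) ^ (-4 : ℝ)) := mul_le_mul_of_nonneg_left hcmp hK0
        _ = 16 * K * (1 + ‖y‖) ^ (-4 : ℝ) := by ring
        _ ≤ (16 * K + B * (1 + Rf) ^ 4) * (1 + ‖y‖) ^ (-4 : ℝ) := by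
            have : 0 ≤ B * (1 + Rf) ^ 4 * (1 + ‖y‖) ^ (-4 : ℝ) := by positivity
            nlinarith
    · -- near: continuity bound
      have hyB : |(Δ W) y| ≤ B := by
        have := hB y (by rw [mem_closedBall, dist_zero_right]; exact hy.le)
        rwa [Real.norm_eq_abs] at this
      have hcmp : 1 ≤ (1 + Rf) ^ 4 * (1 + ‖y‖) ^ (-4 : ℝ) := by
        rw [Real.rpow_neg h1y.le, ← div_eq_mul_inv, le_div_iff₀ (by positivity), one_mul,
          show ((1 + ‖y‖) ^ (4 : ℝ)) = (1 + ‖y‖) ^ ((4 : ℕ) : ℝ) by norm_num, Real.rpow_natCast]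
        exact pow_le_pow_left₀ h1y.le (by linarith) 4
      calc |(Δ W) y| ≤ B := hyB
        _ ≤ B * ((1 + Rf) ^ 4 * (1 + ‖y‖) ^ (-4 : ℝ)) := le_mul_of_one_le_right hB0 hcmp
        _ = B * (1 + Rf) ^ 4 * (1 + ‖y‖) ^ (-4 : ℝ) := by ring
        _ ≤ (16 * K + B * (1 + Rf) ^ 4) * (1 + ‖y‖) ^ (-4 : ℝ) := by
            have : 0 ≤ 16 * K * (1 + ‖y‖) ^ (-4 : ℝ) := by positivity
            nlinarith
  -- Green: `W = O(1/r)`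
  have hO := isBigO_inv_norm_of_laplacian_decay hW2 hW0 hΔW
  obtain ⟨c, hc, hcO⟩ := hO.exists_pos
  obtain ⟨R₁, hR₁⟩ := exists_radius_of_eventually_cobounded hcO.bound
  refine ⟨c, max R₁ (2 * ρ + 2) + 1, fun x hx => ?_⟩
  have hx1 : R₁ < ‖x‖ := by linarith [le_max_left R₁ (2 * ρ + 2)]
  have hx2 : 2 * ρ + 2 < ‖x‖ := by linarith [le_max_right R₁ (2 * ρ + 2)]
  have h := hR₁ x hx1
  rw [Real.norm_eq_abs, (hWu x hx2).self_of_nhds, norm_inv, norm_norm] at h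
  exact h

/- ═══════════ Body6 ═══════════ -/

namespace AFEnd

variable {X : Type} [TopologicalSpace X] [ChartedSpace E3 X] [IsManifold (𝓡 3) ∞ X]
  (e : AFEnd X) (D : InitialDataSet (𝓡 3) X)

/-- `r⁻ᵖ ≤ 2ᵖ (1 + r)⁻ᵖ` for `r ≥ 1`, `p ≥ 0`. [folklore] -/
theorem rpow_neg_le_two_rpow_mul {r p : ℝ} (hr : 1 ≤ r) (hp : 0 ≤ p) :
    r ^ (-p) ≤ (2 : ℝ) ^ p * (1 + r) ^ (-p) := by
  have hr0 : 0 < r := by linarith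
  have h1 : 0 < 1 + r := by linarith
  have h2 : (2 * r) ^ (-p) ≤ (1 + r) ^ (-p) :=
    Real.rpow_le_rpow_of_nonpos h1 (by linarith) (by linarith)
  have h3 : (2 * r) ^ (-p) = ((2 : ℝ) ^ p)⁻¹ * r ^ (-p) := by
    rw [Real.mul_rpow (by norm_num) hr0.le, Real.rpow_neg (by norm_num : (0 : ℝ) ≤ 2)]
  rw [h3] at h2
  have h2p : 0 < (2 : ℝ) ^ p := Real.rpow_pos_of_pos two_pos p
  calc r ^ (-p) = (2 : ℝ) ^ p * (((2 : ℝ) ^ p)⁻¹ * r ^ (-p)) := by field_simp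
    _ ≤ (2 : ℝ) ^ p * (1 + r) ^ (-p) := mul_le_mul_of_nonneg_left h2 h2p.le

set_option maxHeartbeats 800000 in
/-- **The monopole term from Green's representation and the bounded moments of the scalar
curvature.** Let `u` be smooth on `{|y| > ρ}` with `|u| ≤ C r⁻¹`, and suppose its flat Laplacian
is the chart scalar curvature up to a quintic error, `|Δu − R∘Φ/8| ≤ K r⁻⁵`, `|R∘Φ| ≤ K r⁻⁴`, on
an end with `h − δ = O₂(r⁻²)`. Then `u = A/r + O(r⁻²)` pointwise: Green's representation of a
cut-off of `u` (`Literature.Analysis.Potential.isBigO_sub_integral_laplacian_mul_inv_norm`), whose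
moment hypothesis holds because the truncated first moments of `R∘Φ` are bounded
(`exists_bound_norm_setIntegral_scalarCurvatureCoeff_smul`) and the error is `O(r⁻⁵)`. This is
Schoen–Yau's `v = A/r + ω`, `|ω| ≤ k₁₁/(1 + r²)` ((3.12)–(3.18)).
[cite: SchoenYauPMT1979, Lemma 3.2, (3.12)–(3.18)] -/
theorem exists_monopole_of_laplacian [D.metric.HasLeviCivita] (hAF : e.IsMetricAsymptoticallyFlat D 2)
    {u : E3 → ℝ} {ρ C K R : ℝ} (hρ : 0 ≤ ρ) (hu : ContDiffOn ℝ ∞ u {y : E3 | ρ < ‖y‖})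
    (hdecay : ∀ y : E3, R ≤ ‖y‖ → |u y| ≤ C * ‖y‖ ^ (-1 : ℝ))
    (hR : ∀ y : E3, R ≤ ‖y‖ → |scalarCurvatureCoeff e D y| ≤ K * ‖y‖ ^ (-4 : ℝ))
    (hΔ : ∀ y : E3, R ≤ ‖y‖ → |(Δ u) y - 8⁻¹ * scalarCurvatureCoeff e D y| ≤ K * ‖y‖ ^ (-5 : ℝ)) :
    ∃ A C' R' : ℝ, ∀ x : E3, R' ≤ ‖x‖ → |u x - A * ‖x‖⁻¹| ≤ C' * ‖x‖ ^ (-2 : ℝ) := by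
  obtain ⟨W, hW, hWu, hWle, -⟩ := exists_smooth_cutoff_mul hρ hu
  have hW2 : ContDiff ℝ 2 W := hW.of_le (by norm_cast)
  -- `W → 0` at infinity
  have hW0 : Tendsto W (cobounded E3) (𝓝 0) := by
    rw [tendsto_zero_iff_norm_tendsto_zero]
    have hlim : Tendsto (fun y : E3 => C * ‖y‖ ^ (-(1 : ℝ))) (cobounded E3) (𝓝 0) := by
      have h := ((tendsto_rpow_neg_atTop one_pos).comp
        (tendsto_norm_cobounded_atTop (E := E3))).const_mul C
      rw [mul_zero] at h
      exact h
    refine squeeze_zero' (Eventually.of_forall fun y => norm_nonneg _) ?_ hlim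
    filter_upwards [eventually_cobounded_lt_norm (E := E3) R] with y hy
    rw [Real.norm_eq_abs]
    exact (hWle y).trans (hdecay y hy.le)
  -- `K ≥ 0` and the far threshold
  set Rf : ℝ := max (max R (2 * ρ + 3)) 1 with hRf
  have hRf1 : 1 ≤ Rf := le_max_right _ _
  have hfar : ∀ {y : E3}, Rf ≤ ‖y‖ → R ≤ ‖y‖ ∧ 2 * ρ + 2 < ‖y‖ ∧ 1 ≤ ‖y‖ := fun hy =>
    ⟨le_trans (le_trans (le_max_left _ _) (le_max_left _ _)) hy,
      by have := le_trans (le_trans (le_max_right _ _) (le_max_left _ _)) hy; linarith,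
      le_trans (le_max_right _ _) hy⟩
  have hK0 : 0 ≤ K := by
    obtain ⟨y, hy⟩ := NormedSpace.exists_lt_norm ℝ E3 Rf
    obtain ⟨hyR, -, hy1⟩ := hfar hy.le
    have h := (abs_nonneg _).trans (hR y hyR)
    have hp : 0 < ‖y‖ ^ (-4 : ℝ) := Real.rpow_pos_of_pos (by linarith) _
    by_contra hneg
    have : K * ‖y‖ ^ (-4 : ℝ) < 0 := mul_neg_of_neg_of_pos (lt_of_not_ge hneg) hp
    linarith
  -- the Laplacian of `W`: continuity bound near, `Δu` far
  have hΔc : Continuous (Δ W) := Literature.Analysis.FluidPDE.continuous_laplacian hW2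
  have hΔfar : ∀ {y : E3}, Rf ≤ ‖y‖ → (Δ W) y = (Δ u) y := fun hy =>
    (laplacian_congr_nhds (hWu _ (hfar hy).2.1)).self_of_nhds
  have hΔu : ∀ {y : E3}, Rf ≤ ‖y‖ → |(Δ u) y| ≤ 2 * K * ‖y‖ ^ (-4 : ℝ) := by
    intro y hy
    obtain ⟨hyR, -, hy1⟩ := hfar hy
    have h54 : ‖y‖ ^ (-5 : ℝ) ≤ ‖y‖ ^ (-4 : ℝ) :=
      Real.rpow_le_rpow_of_exponent_le hy1 (by norm_num)
    calc |(Δ u) y| = |((Δ u) y - 8⁻¹ * scalarCurvatureCoeff e D y) + 8⁻¹ * scalarCurvatureCoeff e D y| := by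
          ring_nf
      _ ≤ |(Δ u) y - 8⁻¹ * scalarCurvatureCoeff e D y| + |8⁻¹ * scalarCurvatureCoeff e D y| :=
          abs_add_le _ _
      _ ≤ K * ‖y‖ ^ (-5 : ℝ) + 8⁻¹ * (K * ‖y‖ ^ (-4 : ℝ)) := by
          rw [abs_mul, abs_of_pos (by norm_num : (0 : ℝ) < 8⁻¹)]
          exact add_le_add (hΔ y hyR) (mul_le_mul_of_nonneg_left (hR y hyR) (by norm_num))
      _ ≤ 2 * K * ‖y‖ ^ (-4 : ℝ) := by
          have := mul_le_mul_of_nonneg_left h54 hK0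
          nlinarith [Real.rpow_nonneg (norm_nonneg y) (-4 : ℝ)]
  -- the moment data of the scalar curvature and the indicator threshold
  obtain ⟨CM, R₂, hRR₂, hM⟩ := e.exists_bound_norm_setIntegral_scalarCurvatureCoeff_smul D hAF
  have hCM0 : 0 ≤ CM := (norm_nonneg _).trans (hM R₂ R₂ le_rfl le_rfl)
  set T : ℝ := max Rf R₂ with hT
  have hTf : Rf ≤ T := le_max_left _ _
  have hT₂ : R₂ ≤ T := le_max_right _ _
  have hT1 : 1 ≤ T := hRf1.trans hTf
  have hTR : e.R < T := lt_of_lt_of_le hRR₂ hT₂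
  obtain ⟨B, hB⟩ := (isCompact_closedBall (0 : E3) T).exists_bound_of_continuousOn hΔc.continuousOn
  have hB0 : 0 ≤ B := (norm_nonneg _).trans (hB 0 (mem_closedBall_self (by positivity)))
  have hBy : ∀ {y : E3}, ‖y‖ ≤ T → |(Δ W) y| ≤ B := fun hy => by
    have := hB _ (by rwa [mem_closedBall, dist_zero_right])
    rwa [Real.norm_eq_abs] at this
  -- (i) the global quartic bound on `ΔW`
  have hΔW : ∀ y : E3, |(Δ W) y| ≤ (32 * K + B * (1 + T) ^ 4) * (1 + ‖y‖) ^ (-4 : ℝ) := by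
    intro y
    have h1y : 0 < 1 + ‖y‖ := by positivity
    have hpos : 0 < (1 + ‖y‖) ^ (-4 : ℝ) := Real.rpow_pos_of_pos h1y _
    rcases le_or_gt T ‖y‖ with hy | hy
    · have hyf : Rf ≤ ‖y‖ := hTf.trans hy
      obtain ⟨-, -, hy1⟩ := hfar hyf
      rw [hΔfar hyf]
      have hcmp := rpow_neg_le_two_rpow_mul hy1 (by norm_num : (0 : ℝ) ≤ 4)
      have h16 : (2 : ℝ) ^ (4 : ℝ) = 16 := by
        rw [show (4 : ℝ) = ((4 : ℕ) : ℝ) by norm_num, Real.rpow_natCast]; norm_num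
      rw [h16] at hcmp
      calc |(Δ u) y| ≤ 2 * K * ‖y‖ ^ (-4 : ℝ) := hΔu hyf
        _ ≤ 2 * K * (16 * (1 + ‖y‖) ^ (-4 : ℝ)) := mul_le_mul_of_nonneg_left hcmp (by positivity)
        _ ≤ (32 * K + B * (1 + T) ^ 4) * (1 + ‖y‖) ^ (-4 : ℝ) := by
            have : 0 ≤ B * (1 + T) ^ 4 * (1 + ‖y‖) ^ (-4 : ℝ) := by positivity
            nlinarith
    · have hcmp : 1 ≤ (1 + T) ^ 4 * (1 + ‖y‖) ^ (-4 : ℝ) := by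
        rw [Real.rpow_neg h1y.le, ← div_eq_mul_inv, le_div_iff₀ (by positivity), one_mul,
          show ((1 + ‖y‖) ^ (4 : ℝ)) = (1 + ‖y‖) ^ ((4 : ℕ) : ℝ) by norm_num, Real.rpow_natCast]
        exact pow_le_pow_left₀ h1y.le (by linarith) 4
      calc |(Δ W) y| ≤ B := hBy hy.le
        _ ≤ B * ((1 + T) ^ 4 * (1 + ‖y‖) ^ (-4 : ℝ)) := le_mul_of_one_le_right hB0 hcmp
        _ ≤ (32 * K + B * (1 + T) ^ 4) * (1 + ‖y‖) ^ (-4 : ℝ) := by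
            have : 0 ≤ 32 * K * (1 + ‖y‖) ^ (-4 : ℝ) := by positivity
            nlinarith
  -- (ii) the moments: `ΔW = F₁ + F₂`
  set S : Set E3 := {y : E3 | T < ‖y‖} with hS
  have hSo : IsOpen S := isOpen_lt continuous_const continuous_norm
  have hSm : MeasurableSet S := hSo.measurableSet
  set F₁ : E3 → ℝ := S.indicator fun y => 8⁻¹ * scalarCurvatureCoeff e D y with hF₁
  set F₂ : E3 → ℝ := fun y => (Δ W) y - F₁ y with hF₂
  have hF₁S : ∀ {y : E3}, T < ‖y‖ → F₁ y = 8⁻¹ * scalarCurvatureCoeff e D y := fun hy =>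
    indicator_of_mem (show _ ∈ S from hy) _
  have hF₁0 : ∀ {y : E3}, ‖y‖ ≤ T → F₁ y = 0 := fun hy =>
    indicator_of_notMem (show _ ∉ S from fun h => absurd (show T < _ from h) (not_lt.2 hy)) _
  -- measurability
  have hRcont : ContinuousOn (fun y => 8⁻¹ * scalarCurvatureCoeff e D y) S :=
    (continuousOn_const.mul (e.continuousOn_scalarCurvatureCoeff D)).mono fun y hy =>
      lt_trans hTR hy
  have hF₁m : AEStronglyMeasurable F₁ volume :=
    (aestronglyMeasurable_indicator_iff hSm).2 (hRcont.aestronglyMeasurable hSm)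
  have hF₂m : AEStronglyMeasurable F₂ volume := hΔc.aestronglyMeasurable.sub hF₁m
  -- the bound `‖F₂ y • y‖ ≤ K₂ (1 + ‖y‖)⁻⁴`
  have hF₂b : ∀ y : E3, ‖F₂ y • y‖ ≤ (16 * K + B * T * (1 + T) ^ 4) * (1 + ‖y‖) ^ (-4 : ℝ) := by
    intro y
    have h1y : 0 < 1 + ‖y‖ := by positivity
    have hpos : 0 < (1 + ‖y‖) ^ (-4 : ℝ) := Real.rpow_pos_of_pos h1y _
    rw [norm_smul, Real.norm_eq_abs]
    rcases le_or_gt ‖y‖ T with hy | hy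
    · rw [hF₂]
      simp only
      rw [hF₁0 hy, sub_zero]
      have hcmp : 1 ≤ (1 + T) ^ 4 * (1 + ‖y‖) ^ (-4 : ℝ) := by
        rw [Real.rpow_neg h1y.le, ← div_eq_mul_inv, le_div_iff₀ (by positivity), one_mul,
          show ((1 + ‖y‖) ^ (4 : ℝ)) = (1 + ‖y‖) ^ ((4 : ℕ) : ℝ) by norm_num, Real.rpow_natCast]
        exact pow_le_pow_left₀ h1y.le (by linarith) 4
      calc |(Δ W) y| * ‖y‖ ≤ B * T := mul_le_mul (hBy hy) hy (norm_nonneg _) hB0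
        _ ≤ B * T * ((1 + T) ^ 4 * (1 + ‖y‖) ^ (-4 : ℝ)) :=
            le_mul_of_one_le_right (by positivity) hcmp
        _ ≤ (16 * K + B * T * (1 + T) ^ 4) * (1 + ‖y‖) ^ (-4 : ℝ) := by
            have : 0 ≤ 16 * K * (1 + ‖y‖) ^ (-4 : ℝ) := by positivity
            nlinarith
    · have hyf : Rf ≤ ‖y‖ := hTf.trans hy.le
      obtain ⟨hyR, -, hy1⟩ := hfar hyf
      have hy0 : 0 < ‖y‖ := by linarith
      have hval : F₂ y = (Δ u) y - 8⁻¹ * scalarCurvatureCoeff e D y := by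
        rw [hF₂]
        simp only
        rw [hF₁S hy, hΔfar hyf]
      rw [hval]
      have hcmp := rpow_neg_le_two_rpow_mul hy1 (by norm_num : (0 : ℝ) ≤ 4)
      have h16 : (2 : ℝ) ^ (4 : ℝ) = 16 := by
        rw [show (4 : ℝ) = ((4 : ℕ) : ℝ) by norm_num, Real.rpow_natCast]; norm_num
      rw [h16] at hcmp
      have h54 : ‖y‖ ^ (-5 : ℝ) * ‖y‖ = ‖y‖ ^ (-4 : ℝ) := by
        rw [show (-5 : ℝ) = -4 - 1 by norm_num, Real.rpow_sub hy0, Real.rpow_one]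
        field_simp
      calc |(Δ u) y - 8⁻¹ * scalarCurvatureCoeff e D y| * ‖y‖ ≤ K * ‖y‖ ^ (-5 : ℝ) * ‖y‖ :=
            mul_le_mul_of_nonneg_right (hΔ y hyR) (norm_nonneg _)
        _ = K * ‖y‖ ^ (-4 : ℝ) := by rw [mul_assoc, h54]
        _ ≤ K * (16 * (1 + ‖y‖) ^ (-4 : ℝ)) := mul_le_mul_of_nonneg_left hcmp hK0
        _ ≤ (16 * K + B * T * (1 + T) ^ 4) * (1 + ‖y‖) ^ (-4 : ℝ) := by
            have : 0 ≤ B * T * (1 + T) ^ 4 * (1 + ‖y‖) ^ (-4 : ℝ) := by positivity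
            nlinarith
  -- integrability of `F₂ • y` and its moment bound
  have h34 : (Module.finrank ℝ E3 : ℝ) < 4 := by rw [finrank_euclideanSpace_fin]; norm_num
  have hdom : Integrable (fun y : E3 => (16 * K + B * T * (1 + T) ^ 4) * (1 + ‖y‖) ^ (-(4 : ℝ))) :=
    (integrable_one_add_norm h34).const_mul _
  have hF₂i : Integrable fun y : E3 => F₂ y • y :=
    hdom.mono' (hF₂m.smul aestronglyMeasurable_id) (ae_of_all _ hF₂b)
  set M₂ : ℝ := ∫ y : E3, (16 * K + B * T * (1 + T) ^ 4) * (1 + ‖y‖) ^ (-(4 : ℝ)) with hM₂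
  have hmom₂ : ∀ s : Set E3, ‖∫ y in s, F₂ y • y‖ ≤ M₂ := fun s =>
    calc ‖∫ y in s, F₂ y • y‖ ≤ ∫ y in s, ‖F₂ y • y‖ := norm_integral_le_integral_norm _
      _ ≤ ∫ y, ‖F₂ y • y‖ := setIntegral_le_integral hF₂i.norm (ae_of_all _ fun y => norm_nonneg _)
      _ ≤ M₂ := integral_mono hF₂i.norm hdom hF₂b
  -- the moment bound for `F₁` over balls (shells of the scalar curvature)
  have hmom₁ : ∀ ρ' : ℝ, ‖∫ y in ball (0 : E3) ρ', F₁ y • y‖ ≤ 8⁻¹ * CM := by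
    intro ρ'
    have hind : ∀ y : E3, F₁ y • y = S.indicator (fun y => (8⁻¹ : ℝ) • (scalarCurvatureCoeff e D y • y)) y := by
      intro y
      by_cases hy : y ∈ S
      · rw [hF₁, indicator_of_mem hy, indicator_of_mem hy, smul_smul]
      · rw [hF₁, indicator_of_notMem hy, indicator_of_notMem hy, zero_smul]
    simp_rw [hind]
    rw [setIntegral_indicator hSm]
    have hset : ball (0 : E3) ρ' ∩ S = {y : E3 | T < ‖y‖ ∧ ‖y‖ < ρ'} := by
      ext y
      simp only [mem_inter_iff, mem_ball_zero_iff, hS, mem_setOf_eq]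
      tauto
    rw [hset, integral_smul, norm_smul, Real.norm_eq_abs, abs_of_pos (by norm_num : (0 : ℝ) < 8⁻¹)]
    refine mul_le_mul_of_nonneg_left ?_ (by norm_num)
    by_cases hρ' : T ≤ ρ'
    · exact hM T ρ' hT₂ hρ'
    · have hempty : {y : E3 | T < ‖y‖ ∧ ‖y‖ < ρ'} = ∅ := by
        ext y
        simp only [mem_setOf_eq, mem_empty_iff_false, iff_false, not_and, not_lt]
        intro hy
        linarith
      rw [hempty, Measure.restrict_empty, integral_zero_measure, norm_zero]
      exact hCM0
  -- the moment bound for `ΔW`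
  have hmom : ∀ ρ' : ℝ, 1 ≤ ρ' → ‖∫ y in ball (0 : E3) ρ', (Δ W) y • y‖ ≤ 8⁻¹ * CM + M₂ := by
    intro ρ' _
    have hΔi : IntegrableOn (fun y => (Δ W) y • y) (ball (0 : E3) ρ') :=
      ((hΔc.smul continuous_id).continuousOn.integrableOn_compact
        (isCompact_closedBall (0 : E3) ρ')).mono_set ball_subset_closedBall
    have hF₂iB : IntegrableOn (fun y => F₂ y • y) (ball (0 : E3) ρ') := hF₂i.integrableOn
    have hF₁iB : IntegrableOn (fun y => F₁ y • y) (ball (0 : E3) ρ') := by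
      have h := hΔi.sub hF₂iB
      refine h.congr_fun (fun y _ => ?_) measurableSet_ball
      show (Δ W) y • y - ((Δ W) y - F₁ y) • y = F₁ y • y
      rw [sub_smul, sub_sub_cancel]
    have hsplit : ∫ y in ball (0 : E3) ρ', (Δ W) y • y =
        (∫ y in ball (0 : E3) ρ', F₁ y • y) + ∫ y in ball (0 : E3) ρ', F₂ y • y := by
      rw [← integral_add hF₁iB hF₂iB]
      refine integral_congr_ae (ae_of_all _ fun y => ?_)
      simp only [hF₂, sub_smul]
      abel
    rw [hsplit]
    exact (norm_add_le _ _).trans (add_le_add (hmom₁ ρ') (hmom₂ _))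
  -- (iii) Green's expansion
  have hO := isBigO_sub_integral_laplacian_mul_inv_norm hW2 hW0 hΔW hmom
  obtain ⟨c, hc, hcO⟩ := hO.exists_pos
  obtain ⟨R₁, hR₁⟩ := exists_radius_of_eventually_cobounded hcO.bound
  refine ⟨-(4 * Real.pi)⁻¹ * ∫ y, (Δ W) y, c, max R₁ Rf + 1, fun x hx => ?_⟩
  have hx1 : R₁ < ‖x‖ := by linarith [le_max_left R₁ Rf]
  have hxf : Rf ≤ ‖x‖ := by linarith [le_max_right R₁ Rf]
  have h := hR₁ x hx1
  rw [Real.norm_eq_abs, (hWu x (hfar hxf).2.1).self_of_nhds,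
    Real.norm_of_nonneg (Real.rpow_nonneg (norm_nonneg _) _)] at h
  exact h

end AFEnd

/- ═══════════ Body7 ═══════════ -/

/-! ### Subtracting the monopole `A/r`: the equation for `u − A/r` -/

/-- `1/r` is smooth on `{|y| > ρ}` for `ρ ≥ 0`. [folklore] -/
theorem contDiffOn_inv_norm {ρ : ℝ} (hρ : 0 ≤ ρ) :
    ContDiffOn ℝ ∞ (fun z : E3 => ‖z‖⁻¹) {z : E3 | ρ < ‖z‖} := fun z hz => by
  have hz0 : z ≠ 0 := norm_pos_iff.1 (lt_of_le_of_lt hρ hz)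
  exact ((contDiffAt_norm ℝ hz0).inv (norm_ne_zero_iff.2 hz0)).contDiffWithinAt

/-- First and second partial derivatives of `u − Aψ` on an open set where both are smooth.
[folklore] -/
theorem partials_sub_const_mul {u ψ : E3 → ℝ} {U : Set E3} (hU : IsOpen U)
    (hu : ContDiffOn ℝ ∞ u U) (hψ : ContDiffOn ℝ ∞ ψ U) (A : ℝ) {y : E3} (hy : y ∈ U) :
    (∀ v, fderiv ℝ (fun z => u z - A * ψ z) y v = fderiv ℝ u y v - A * fderiv ℝ ψ y v) ∧
    (∀ v w, fderiv ℝ (fun z => fderiv ℝ (fun z' => u z' - A * ψ z') z v) y w =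
      fderiv ℝ (fun z => fderiv ℝ u z v) y w - A * fderiv ℝ (fun z => fderiv ℝ ψ z v) y w) := by
  have h1 : ∀ z ∈ U, ∀ v, fderiv ℝ (fun z => u z - A * ψ z) z v =
      fderiv ℝ u z v - A * fderiv ℝ ψ z v := by
    intro z hz v
    have hud : DifferentiableAt ℝ u z := (hu.contDiffAt (hU.mem_nhds hz)).differentiableAt (by simp)
    have hψd : DifferentiableAt ℝ ψ z := (hψ.contDiffAt (hU.mem_nhds hz)).differentiableAt (by simp)
    have h : HasFDerivAt (fun z => u z - A * ψ z) (fderiv ℝ u z - A • fderiv ℝ ψ z) z :=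
      hud.hasFDerivAt.sub (hψd.hasFDerivAt.const_mul A)
    rw [h.fderiv]
    simp [smul_eq_mul]
  refine ⟨h1 y hy, fun v w => ?_⟩
  have hev : (fun z => fderiv ℝ (fun z' => u z' - A * ψ z') z v) =ᶠ[𝓝 y]
      fun z => fderiv ℝ u z v - A * fderiv ℝ ψ z v :=
    Filter.eventually_of_mem (hU.mem_nhds hy) fun z hz => h1 z hz v
  rw [hev.fderiv_eq]
  have hdu : DifferentiableAt ℝ (fun z => fderiv ℝ u z v) y := by
    have h := ((hu.contDiffAt (hU.mem_nhds hy)).fderiv_right (m := 1) (by norm_cast)).differentiableAt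
      one_ne_zero
    exact h.clm_apply (differentiableAt_const v)
  have hdψ : DifferentiableAt ℝ (fun z => fderiv ℝ ψ z v) y := by
    have h := ((hψ.contDiffAt (hU.mem_nhds hy)).fderiv_right (m := 1) (by norm_cast)).differentiableAt
      one_ne_zero
    exact h.clm_apply (differentiableAt_const v)
  have h : HasFDerivAt (fun z => fderiv ℝ u z v - A * fderiv ℝ ψ z v)
      (fderiv ℝ (fun z => fderiv ℝ u z v) y - A • fderiv ℝ (fun z => fderiv ℝ ψ z v) y) y :=
    hdu.hasFDerivAt.sub (hdψ.hasFDerivAt.const_mul A)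
  rw [h.fderiv]
  simp [smul_eq_mul]

/-- **`1/r` is harmonic in `ℝ³`** along an orthonormal basis: `Σₖ ∂ₖ∂ₖ(1/r)(y) = 0` for `y ≠ 0`
(`MetricCoord.sum_fderiv_fderiv_inv_norm`). [folklore] -/
theorem sum_partial_partial_inv_norm (b : OrthonormalBasis (Fin 3) ℝ E3) {y : E3} (hy : y ≠ 0) :
    ∑ k, fderiv ℝ (fun z => fderiv ℝ (fun z' : E3 => ‖z'‖⁻¹) z (b k)) y (b k) = 0 := by
  have hψ2 : ContDiffAt ℝ 2 (fun z' : E3 => ‖z'‖⁻¹) y :=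
    ((contDiffAt_norm ℝ hy).inv (norm_ne_zero_iff.2 hy)).of_le (by norm_cast)
  have h := MetricCoord.sum_fderiv_fderiv_inv_norm b hy
  rw [Fintype.card_fin] at h
  norm_num at h
  rw [← h]
  exact Finset.sum_congr rfl fun k _ => fderiv_fderiv_apply_eq_fderiv_fderiv hψ2 _ _

/-- **The equation for `u − A/r`.** If `Pu := Σ aₖₗ∂ₗ∂ₖu + Σ βₘ∂ₘu + cu = g` on `{|y| > ρ}`
(`ρ ≥ 0`), then `P(u − A/r) = g − A·E` there, with the *monopole error*
`E = Σ (aₖₗ − δₖₗ) ∂ₗ∂ₖ(1/r) + Σ βₘ ∂ₘ(1/r) + c/r` (since `Σₖ ∂ₖ∂ₖ(1/r) = 0`). This is the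
equation (3.19)-type step behind Schoen–Yau's derivative bounds (3.20) for `ω = v − A/r`.
[cite: SchoenYauPMT1979, Lemma 3.2, (3.18)–(3.20)] -/
theorem sub_monopole_equation (b : OrthonormalBasis (Fin 3) ℝ E3) {u g : E3 → ℝ}
    {a : Fin 3 → Fin 3 → E3 → ℝ} {β : Fin 3 → E3 → ℝ} {c : E3 → ℝ} {ρ : ℝ} (hρ : 0 ≤ ρ)
    (hu : ContDiffOn ℝ ∞ u {y : E3 | ρ < ‖y‖})
    (heq : ∀ y : E3, ρ < ‖y‖ →
      ∑ k, ∑ l, a k l y * fderiv ℝ (fun z' => fderiv ℝ u z' (b k)) y (b l)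
        + ∑ k, β k y * fderiv ℝ u y (b k) + c y * u y = g y)
    (A : ℝ) {y : E3} (hy : ρ < ‖y‖) :
    ∑ k, ∑ l, a k l y * fderiv ℝ (fun z' => fderiv ℝ (fun z => u z - A * ‖z‖⁻¹) z' (b k)) y (b l)
        + ∑ k, β k y * fderiv ℝ (fun z => u z - A * ‖z‖⁻¹) y (b k)
        + c y * (u y - A * ‖y‖⁻¹)
      = g y - A * (∑ k, ∑ l, (a k l y - if k = l then 1 else 0)
            * fderiv ℝ (fun z => fderiv ℝ (fun z' : E3 => ‖z'‖⁻¹) z (b k)) y (b l)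
          + ∑ k, β k y * fderiv ℝ (fun z' : E3 => ‖z'‖⁻¹) y (b k) + c y * ‖y‖⁻¹) := by
  have hU : IsOpen {y : E3 | ρ < ‖y‖} := isOpen_lt continuous_const continuous_norm
  have hψ := contDiffOn_inv_norm hρ
  have hy0 : y ≠ 0 := norm_pos_iff.1 (lt_of_le_of_lt hρ hy)
  obtain ⟨h1, h2⟩ := partials_sub_const_mul hU hu hψ A hy
  simp_rw [h2, h1]
  rw [← heq y hy]
  have hharm := sum_partial_partial_inv_norm b hy0
  -- the `δ` part of `Σ aₖₗ ∂ₗ∂ₖ(1/r)` vanishes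
  have hδ : ∑ k, ∑ l, (if k = l then (1 : ℝ) else 0)
      * fderiv ℝ (fun z => fderiv ℝ (fun z' : E3 => ‖z'‖⁻¹) z (b k)) y (b l) = 0 := by
    have h : ∑ k, ∑ l, (if k = l then (1 : ℝ) else 0)
        * fderiv ℝ (fun z => fderiv ℝ (fun z' : E3 => ‖z'‖⁻¹) z (b k)) y (b l)
        = ∑ k, fderiv ℝ (fun z => fderiv ℝ (fun z' : E3 => ‖z'‖⁻¹) z (b k)) y (b k) :=
      Finset.sum_congr rfl fun k _ => by
        simp only [ite_mul, one_mul, zero_mul, Finset.sum_ite_eq, Finset.mem_univ, if_true]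
    rw [h, hharm]
  have hsplit : ∑ k, ∑ l, (a k l y - if k = l then 1 else 0)
      * fderiv ℝ (fun z => fderiv ℝ (fun z' : E3 => ‖z'‖⁻¹) z (b k)) y (b l)
      = ∑ k, ∑ l, a k l y * fderiv ℝ (fun z => fderiv ℝ (fun z' : E3 => ‖z'‖⁻¹) z (b k)) y (b l) := by
    have : ∑ k, ∑ l, (a k l y - if k = l then 1 else 0)
        * fderiv ℝ (fun z => fderiv ℝ (fun z' : E3 => ‖z'‖⁻¹) z (b k)) y (b l)
        = ∑ k, ∑ l, a k l y * fderiv ℝ (fun z => fderiv ℝ (fun z' : E3 => ‖z'‖⁻¹) z (b k)) y (b l)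
          - ∑ k, ∑ l, (if k = l then (1 : ℝ) else 0)
            * fderiv ℝ (fun z => fderiv ℝ (fun z' : E3 => ‖z'‖⁻¹) z (b k)) y (b l) := by
      rw [← Finset.sum_sub_distrib]
      refine Finset.sum_congr rfl fun k _ => ?_
      rw [← Finset.sum_sub_distrib]
      exact Finset.sum_congr rfl fun l _ => by ring
    rw [this, hδ, sub_zero]
  rw [hsplit]
  have hx2 : ∑ k, ∑ l, a k l y * (A * fderiv ℝ (fun z => fderiv ℝ (fun z' : E3 => ‖z'‖⁻¹) z (b k)) y (b l))
      = A * ∑ k, ∑ l, a k l y * fderiv ℝ (fun z => fderiv ℝ (fun z' : E3 => ‖z'‖⁻¹) z (b k)) y (b l) := by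
    rw [Finset.mul_sum]
    refine Finset.sum_congr rfl fun k _ => ?_
    rw [Finset.mul_sum]
    exact Finset.sum_congr rfl fun l _ => by ring
  have hx1 : ∑ k, β k y * (A * fderiv ℝ (fun z' : E3 => ‖z'‖⁻¹) y (b k))
      = A * ∑ k, β k y * fderiv ℝ (fun z' : E3 => ‖z'‖⁻¹) y (b k) := by
    rw [Finset.mul_sum]
    exact Finset.sum_congr rfl fun k _ => by ring
  simp only [mul_sub, Finset.sum_sub_distrib, hx2, hx1]
  ring

/-! ### The monopole error is a symbol of order `−5` -/

namespace AFEnd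

variable {X : Type} [TopologicalSpace X] [ChartedSpace E3 X] [IsManifold (𝓡 3) ∞ X]
  (e : AFEnd X) (D : InitialDataSet (𝓡 3) X)

/-- **The monopole error of the chart equation is `O_2(r⁻⁵)`**:
`E = Σ (aₖₗ − δₖₗ) ∂ₗ∂ₖ(1/r) + Σ βₘ ∂ₘ(1/r) − (R∘Φ/8)/r` with `a − δ ∈ O(r⁻²)`, `β ∈ O(r⁻³)`,
`R∘Φ ∈ O(r⁻⁴)` and `∂ᵏ(1/r) ∈ O(r^{−1−k})`. Hence the source of the equation for `u − A/r`,
`R∘Φ/8 − A E`, is again `O_2(r⁻⁴)`. [cite: SchoenYauPMT1979, Lemma 3.2, (3.19)–(3.20)] -/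
theorem isBigOSmooth_monopoleError [D.metric.HasLeviCivita] (b : OrthonormalBasis (Fin 3) ℝ E3)
    (hH : IsBigOSmooth 4 (-2) fun y ↦ hCoeff e D y - (innerSL ℝ : E3 →L[ℝ] E3 →L[ℝ] ℝ)) :
    IsBigOSmooth 2 (-5) fun y ↦
      ∑ k, ∑ l, (MetricCoord.ginv (hCoeff e D) b.toBasis y l k - if k = l then 1 else 0)
          * fderiv ℝ (fun z => fderiv ℝ (fun z' : E3 => ‖z'‖⁻¹) z (b k)) y (b l)
        + ∑ m, (-(2⁻¹ * ∑ k, ∑ l, ∑ j, MetricCoord.ginv (hCoeff e D) b.toBasis y k l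
            * MetricCoord.ginv (hCoeff e D) b.toBasis y m j
            * MetricCoord.koszulCLM (hCoeff e D) y (b k) (b l) (b j)))
          * fderiv ℝ (fun z' : E3 => ‖z'‖⁻¹) y (b m)
        + (-8⁻¹ * scalarCurvatureCoeff e D y) * ‖y‖⁻¹ := by
  have two : (0 : ℝ) < 2 := two_pos
  -- the factors
  have hA : ∀ k l : Fin 3, IsBigOSmooth 2 (-2) fun y ↦
      MetricCoord.ginv (hCoeff e D) b.toBasis y l k - if k = l then 1 else 0 := by
    intro k l
    have h := e.isBigOSmooth_ginv_sub D b (k := 2) (hH.of_le (show 2 ≤ 4 by norm_num)) two l k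
    refine h.congr fun y ↦ ?_
    rcases eq_or_ne k l with h' | h'
    · simp [h']
    · simp [h', h'.symm]
  have hψ4 : IsBigOSmooth 4 (-1) fun y : E3 ↦ ‖y‖⁻¹ := isBigOSmooth_inv_norm_all 4
  have hψ3 : IsBigOSmooth 3 (-1) fun y : E3 ↦ ‖y‖⁻¹ := isBigOSmooth_inv_norm_all 3
  have hψ2 : IsBigOSmooth 2 (-1) fun y : E3 ↦ ‖y‖⁻¹ := isBigOSmooth_inv_norm_all 2
  have hdψ : ∀ m : Fin 3, IsBigOSmooth 2 (-2) fun y ↦ fderiv ℝ (fun z' : E3 => ‖z'‖⁻¹) y (b m) := by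
    intro m
    have h := hψ3.fderiv_apply_const (k := 2) (b m)
    rwa [show (-1 : ℝ) - 1 = -2 by norm_num] at h
  have hddψ : ∀ k l : Fin 3, IsBigOSmooth 2 (-3) fun y ↦
      fderiv ℝ (fun z => fderiv ℝ (fun z' : E3 => ‖z'‖⁻¹) z (b k)) y (b l) := by
    intro k l
    have h := (hψ4.fderiv_apply_const (k := 3) (b k)).fderiv_apply_const (k := 2) (b l)
    rwa [show (-1 : ℝ) - 1 - 1 = -3 by norm_num] at h
  have hB : ∀ m : Fin 3, IsBigOSmooth 2 (-2 - 1) fun y ↦ -(2⁻¹ * ∑ k, ∑ l, ∑ j,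
      MetricCoord.ginv (hCoeff e D) b.toBasis y k l * MetricCoord.ginv (hCoeff e D) b.toBasis y m j
        * MetricCoord.koszulCLM (hCoeff e D) y (b k) (b l) (b j)) := fun m =>
    e.isBigOSmooth_firstOrderCoeff D b (k := 2) (hH.of_le (show 3 ≤ 4 by norm_num)) two m
  have hC : IsBigOSmooth 2 (-2 - 2) (scalarCurvatureCoeff e D) :=
    e.isBigOSmooth_scalarCurvatureCoeff D (k := 2) hH two
  -- the three terms
  have h1 : IsBigOSmooth 2 (-5) fun y ↦
      ∑ k, ∑ l, (MetricCoord.ginv (hCoeff e D) b.toBasis y l k - if k = l then 1 else 0)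
        * fderiv ℝ (fun z => fderiv ℝ (fun z' : E3 => ‖z'‖⁻¹) z (b k)) y (b l) := by
    have h := IsBigOSmooth.finset_sum (Finset.univ : Finset (Fin 3)) fun k _ ↦
      IsBigOSmooth.finset_sum (Finset.univ : Finset (Fin 3)) fun l _ ↦ (hA k l).mul (hddψ k l)
    rwa [show (-2 : ℝ) + -3 = -5 by norm_num] at h
  have h2 : IsBigOSmooth 2 (-5) fun y ↦ ∑ m, (-(2⁻¹ * ∑ k, ∑ l, ∑ j,
      MetricCoord.ginv (hCoeff e D) b.toBasis y k l * MetricCoord.ginv (hCoeff e D) b.toBasis y m j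
        * MetricCoord.koszulCLM (hCoeff e D) y (b k) (b l) (b j)))
        * fderiv ℝ (fun z' : E3 => ‖z'‖⁻¹) y (b m) := by
    have h := IsBigOSmooth.finset_sum (Finset.univ : Finset (Fin 3)) fun m _ ↦ (hB m).mul (hdψ m)
    rwa [show (-2 : ℝ) - 1 + -2 = -5 by norm_num] at h
  have h3 : IsBigOSmooth 2 (-5) fun y ↦ (-8⁻¹ * scalarCurvatureCoeff e D y) * ‖y‖⁻¹ := by
    have h := (hC.const_mul (-8⁻¹)).mul hψ2
    rwa [show (-2 : ℝ) - 2 + -1 = -5 by norm_num] at h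
  exact (h1.add h2).add h3

end AFEnd

/- ═══════════ Body8 ═══════════ -/

/-! ### The asymptotic expansion of the conformal factor -/

set_option maxHeartbeats 1600000 in
/-- **Schoen–Yau 1979, Lemma 3.2 (asymptotic half) for the equation of Lemma 3.3.** On initial
data with one strongly asymptotically flat end (`h − δ = o₅(r⁻²)` in the chart), every smooth
solution `v ∈ L⁶(dV_h)` of `Δ_h v − (R/8) v = R/8` has an expansion

  `v̂ = A/r + O₂(r⁻²)`   (`v̂ = v ∘ Φ` the chart representative, `‖∂^m(v̂ − A/r)‖ = O(r^{−2−m})`,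
  `m ≤ 2`)

for some constant `A` — (3.6)–(3.20) of the paper: the `L⁶` bound gives `L²`-smallness on the
balls `B̄(x, |x|/4)`, the decay bootstrap (`Literature.Analysis.PDE.decay_bootstrap`) turns it
into `v̂, ∂v̂, ∂²v̂ = O(r^{−1/2−k})`, Green's representation of a cut-off gives `v̂ = O(r⁻¹)`
((3.9)), a second bootstrap gives `∂ᵏv̂ = O(r^{−1−k})`, the monopole expansion with the bounded
moments of `R∘Φ` gives `v̂ = A/r + O(r⁻²)` ((3.12)–(3.18)), and a third bootstrap on
`v̂ − A/r` gives the derivative bounds (3.19)–(3.20). This is the hypothesis `hasym` of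
`exists_conformal_negativeMass_of_massZero_of_regularity_and_asymptotics`
(`ConformalScalarFlatElliptic.lean`). [cite: SchoenYauPMT1979, Lemma 3.2, (3.6)–(3.20) (pp. 66–70)] -/
theorem endValue_expansion_of_conformal_solution (X : Type) [TopologicalSpace X]
    [ChartedSpace E3 X] [IsManifold (𝓡 3) ∞ X] [T2Space X] [LocallyCompactSpace X]
    [MeasurableSpace X] [BorelSpace X]
    (D : InitialDataSet (𝓡 3) X) [D.metric.HasLeviCivita] (e : AFEnd X)
    (haf : e.IsStronglyAsymptoticallyFlatWith D 0 2 0 5 0)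
    (v : X → ℝ) (hv : ContMDiff (𝓡 3) 𝓘(ℝ) ∞ v) (hv6 : MemLp v 6 (riemannianMeasure D.h))
    (hpde : ∀ x, D.metric.dalembertian v x - D.metric.scalarCurvature x / 8 * v x =
      D.metric.scalarCurvature x / 8) :
    ∃ A : ℝ, ∀ m : ℕ, m ≤ 2 →
      (fun x ↦ ‖iteratedFDeriv ℝ m (fun y ↦ endValue e v y - A / ‖y‖) x‖)
        =O[cobounded E3] fun x ↦ ‖x‖ ^ (-2 - m : ℝ) := by
  classical
  set b : OrthonormalBasis (Fin 3) ℝ E3 := EuclideanSpace.basisFun (Fin 3) ℝ with hb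
  have hH5 := e.isBigOSmooth_hCoeff_sub_innerSL D haf
  have hH4 : IsBigOSmooth 4 (-2) (fun y ↦ e.hCoeff D y - (innerSL ℝ : E3 →L[ℝ] E3 →L[ℝ] ℝ)) :=
    hH5.of_le (show 4 ≤ 5 by norm_num)
  have hAF : e.IsMetricAsymptoticallyFlat D 2 :=
    AFEnd.IsStronglyAsymptoticallyFlatWith.isMetricAsymptoticallyFlat_of_massZero e D haf (by norm_num)
  -- the chart representative, its smoothness and its equation
  have hρ0 : 0 ≤ e.R := e.R_pos.le
  have hU : IsOpen {y : E3 | e.R < ‖y‖} := isOpen_lt continuous_const continuous_norm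
  have hu : ContDiffOn ℝ ∞ (endValue e v) {y : E3 | e.R < ‖y‖} := fun y hy =>
    (e.contDiffAt_endValue_of_contMDiffAt hy hv.contMDiffAt).contDiffWithinAt
  have heq : ∀ y : E3, e.R < ‖y‖ →
      ∑ k, ∑ l, MetricCoord.ginv (e.hCoeff D) b.toBasis y l k
          * fderiv ℝ (fun z' => fderiv ℝ (endValue e v) z' (b k)) y (b l)
        + ∑ m, (-(2⁻¹ * ∑ k, ∑ l, ∑ j, MetricCoord.ginv (e.hCoeff D) b.toBasis y k l
            * MetricCoord.ginv (e.hCoeff D) b.toBasis y m j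
            * MetricCoord.koszulCLM (e.hCoeff D) y (b k) (b l) (b j))) * fderiv ℝ (endValue e v) y (b m)
        + (-8⁻¹ * e.scalarCurvatureCoeff D y) * endValue e v y = 8⁻¹ * e.scalarCurvatureCoeff D y :=
    fun y hy => e.chartEquation D b hv hpde hy
  have hg : IsBigOSmooth 2 (-4) fun y ↦ 8⁻¹ * e.scalarCurvatureCoeff D y := by
    have h := (e.isBigOSmooth_scalarCurvatureCoeff D (k := 2) hH4 two_pos).const_mul 8⁻¹
    rwa [show (-2 : ℝ) - 2 = -4 by norm_num] at h
  obtain ⟨K, rK, hK, hrK1, hRrK, -, -, -, hcoef⟩ := e.exists_bootstrapCoeff D b hH4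
  have hpow0 : ∀ (y : E3) (s : ℝ), 0 ≤ ‖y‖ ^ s := fun y s => Real.rpow_nonneg (norm_nonneg _) _
  /- ── Stage 1: `L⁶` ⟹ `v̂ = O(r^{-1/2})` with two derivatives ── -/
  obtain ⟨K₀, r₀, hK₀, hI₁⟩ := e.exists_ball_sq_integral_le_of_memLp D two_pos hAF hv.continuous hv6
  obtain ⟨C₁, r₁, hC₁, h₁⟩ := e.bootstrap_stage D b hH4 (q := 2) (by norm_num) hu hg heq hK₀ hI₁
  -- the flat Laplacian of `v̂`
  have hΔsrc : ∀ {C s r : ℝ} {y : E3}, 0 ≤ C → max (max r (rK + 1)) 1 ≤ ‖y‖ →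
      (∀ y : E3, r ≤ ‖y‖ → |endValue e v y| ≤ C * ‖y‖ ^ s ∧
        (∀ m, |fderiv ℝ (endValue e v) y (b m)| ≤ C * ‖y‖ ^ (s - 1)) ∧
        (∀ m n, |fderiv ℝ (fun z => fderiv ℝ (endValue e v) z (b m)) y (b n)| ≤ C * ‖y‖ ^ (s - 2))) →
      |(Δ (endValue e v)) y - 8⁻¹ * e.scalarCurvatureCoeff D y| ≤ 3 * K * C * ‖y‖ ^ (s - 4) ∧
      |e.scalarCurvatureCoeff D y| ≤ 8 * K * ‖y‖ ^ (-4 : ℝ) := by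
    intro C s r y hC hy hbd
    have hyr : r ≤ ‖y‖ := le_trans (le_trans (le_max_left _ _) (le_max_left _ _)) hy
    have hyK : rK + 1 ≤ ‖y‖ := le_trans (le_trans (le_max_right _ _) (le_max_left _ _)) hy
    have hy1 : 1 ≤ ‖y‖ := le_trans (le_max_right _ _) hy
    have hy0 : 0 < ‖y‖ := by linarith
    have hyR : e.R < ‖y‖ := by linarith
    obtain ⟨ha, hβ, hc, -, -⟩ := hcoef y hyK
    obtain ⟨h0, h1', h2'⟩ := hbd y hyr
    have hu2 : ContDiffAt ℝ 2 (endValue e v) y :=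
      ((hu.contDiffAt (hU.mem_nhds hyR)).of_le (by norm_cast))
    refine ⟨abs_laplacian_sub_source_le b (u := endValue e v)
      (g := fun y => 8⁻¹ * e.scalarCurvatureCoeff D y)
      (a := fun k l y => MetricCoord.ginv (e.hCoeff D) b.toBasis y l k)
      (β := fun m y => -(2⁻¹ * ∑ k, ∑ l, ∑ j, MetricCoord.ginv (e.hCoeff D) b.toBasis y k l
            * MetricCoord.ginv (e.hCoeff D) b.toBasis y m j
            * MetricCoord.koszulCLM (e.hCoeff D) y (b k) (b l) (b j)))
      (c := fun y => -8⁻¹ * e.scalarCurvatureCoeff D y)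
      hC hy0 hu2 (heq y hyR) ha hβ hc h0 h1' h2', ?_⟩
    rw [abs_mul, show |(-8⁻¹ : ℝ)| = 8⁻¹ by norm_num] at hc
    linarith
  have h₁' : ∀ y : E3, r₁ ≤ ‖y‖ → |endValue e v y| ≤ C₁ * ‖y‖ ^ (-(1 / 2) : ℝ) ∧
      (∀ m, |fderiv ℝ (endValue e v) y (b m)| ≤ C₁ * ‖y‖ ^ (-(1 / 2) - 1 : ℝ)) ∧
      (∀ m n, |fderiv ℝ (fun z => fderiv ℝ (endValue e v) z (b m)) y (b n)|
        ≤ C₁ * ‖y‖ ^ (-(1 / 2) - 2 : ℝ)) := by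
    intro y hy
    obtain ⟨h0, h1', h2'⟩ := h₁ y hy
    refine ⟨by rwa [show ((2 : ℝ) - 3) / 2 = -(1 / 2) by norm_num] at h0, fun m => ?_, fun m n => ?_⟩
    · have := h1' m; rwa [show ((2 : ℝ) - 5) / 2 = -(1 / 2) - 1 by norm_num] at this
    · have := h2' m n; rwa [show ((2 : ℝ) - 7) / 2 = -(1 / 2) - 2 by norm_num] at this
  set RA : ℝ := max (max r₁ (rK + 1)) 1 with hRA
  have hΔ₁ : ∀ y : E3, RA ≤ ‖y‖ → |(Δ (endValue e v)) y| ≤ (K + 3 * K * C₁) * ‖y‖ ^ (-4 : ℝ) := by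
    intro y hy
    have hy1 : 1 ≤ ‖y‖ := le_trans (le_max_right _ _) hy
    obtain ⟨hlap, hR⟩ := hΔsrc hC₁ hy h₁'
    have hmono : ‖y‖ ^ (-(1 / 2) - 4 : ℝ) ≤ ‖y‖ ^ (-4 : ℝ) :=
      Real.rpow_le_rpow_of_exponent_le hy1 (by norm_num)
    calc |(Δ (endValue e v)) y|
        = |((Δ (endValue e v)) y - 8⁻¹ * e.scalarCurvatureCoeff D y) + 8⁻¹ * e.scalarCurvatureCoeff D y| := by
          ring_nf
      _ ≤ |(Δ (endValue e v)) y - 8⁻¹ * e.scalarCurvatureCoeff D y| + |8⁻¹ * e.scalarCurvatureCoeff D y| :=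
          abs_add_le _ _
      _ ≤ 3 * K * C₁ * ‖y‖ ^ (-(1 / 2) - 4 : ℝ) + 8⁻¹ * (8 * K * ‖y‖ ^ (-4 : ℝ)) := by
          rw [abs_mul, abs_of_pos (by norm_num : (0 : ℝ) < 8⁻¹)]
          exact add_le_add hlap (mul_le_mul_of_nonneg_left hR (by norm_num))
      _ ≤ (K + 3 * K * C₁) * ‖y‖ ^ (-4 : ℝ) := by
          have := mul_le_mul_of_nonneg_left hmono (by positivity : (0 : ℝ) ≤ 3 * K * C₁)
          nlinarith [hpow0 y (-4)]
  have hdec₁ : ∀ y : E3, RA ≤ ‖y‖ → |endValue e v y| ≤ C₁ * ‖y‖ ^ (-(1 / 2) : ℝ) := fun y hy =>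
    (h₁' y (le_trans (le_trans (le_max_left _ _) (le_max_left _ _)) hy)).1
  /- ── Green's representation: `v̂ = O(1/r)` ── -/
  obtain ⟨C₂, R₂, h₂⟩ := exists_inv_norm_bound_of_laplacian_decay hρ0 (s := 1 / 2) (by norm_num)
    hu hdec₁ hΔ₁
  set C₂' : ℝ := max C₂ 0 with hC₂'
  have h₂' : ∀ y : E3, R₂ ≤ ‖y‖ → |endValue e v y| ≤ C₂' * ‖y‖ ^ (-(1 : ℝ)) := fun y hy => by
    rw [Real.rpow_neg_one]
    exact (h₂ y hy).trans (mul_le_mul_of_nonneg_right (le_max_left _ _) (inv_nonneg.2 (norm_nonneg _)))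
  /- ── Stage 2: `∂ᵏ v̂ = O(r^{-1-k})` ── -/
  have hI₂ : ∀ x : E3, max (4 / 3 * R₂) 1 ≤ ‖x‖ →
      ∫ y in closedBall x (1 / 4 * ‖x‖), endValue e v y ^ 2 ≤ 6 * 64 * C₂' ^ 2 * ‖x‖ ^ (1 : ℝ) := by
    intro x hx
    have h := setIntegral_quarterBall_sq_le (le_max_right _ _) zero_le_one (by norm_num) h₂' hx
    rwa [show (-(2 * 1) + 3 : ℝ) = 1 by norm_num] at h
  obtain ⟨C₃, r₃, hC₃, h₃⟩ := e.bootstrap_stage D b hH4 (q := 1) (by norm_num) hu hg heq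
    (by positivity) hI₂
  have h₃' : ∀ y : E3, r₃ ≤ ‖y‖ → |endValue e v y| ≤ C₃ * ‖y‖ ^ (-1 : ℝ) ∧
      (∀ m, |fderiv ℝ (endValue e v) y (b m)| ≤ C₃ * ‖y‖ ^ (-1 - 1 : ℝ)) ∧
      (∀ m n, |fderiv ℝ (fun z => fderiv ℝ (endValue e v) z (b m)) y (b n)|
        ≤ C₃ * ‖y‖ ^ (-1 - 2 : ℝ)) := by
    intro y hy
    obtain ⟨h0, h1', h2'⟩ := h₃ y hy
    refine ⟨by rwa [show ((1 : ℝ) - 3) / 2 = -1 by norm_num] at h0, fun m => ?_, fun m n => ?_⟩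
    · have := h1' m; rwa [show ((1 : ℝ) - 5) / 2 = -1 - 1 by norm_num] at this
    · have := h2' m n; rwa [show ((1 : ℝ) - 7) / 2 = -1 - 2 by norm_num] at this
  set RB : ℝ := max (max r₃ (rK + 1)) 1 with hRB
  have hΔ₅ : ∀ y : E3, RB ≤ ‖y‖ →
      |(Δ (endValue e v)) y - 8⁻¹ * e.scalarCurvatureCoeff D y| ≤ (8 * K + 3 * K * C₃) * ‖y‖ ^ (-5 : ℝ) := by
    intro y hy
    obtain ⟨hlap, -⟩ := hΔsrc hC₃ hy h₃'
    rw [show (-1 - 4 : ℝ) = -5 by norm_num] at hlap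
    exact hlap.trans (mul_le_mul_of_nonneg_right (by nlinarith) (hpow0 y _))
  have hR₄ : ∀ y : E3, RB ≤ ‖y‖ → |e.scalarCurvatureCoeff D y| ≤ (8 * K + 3 * K * C₃) * ‖y‖ ^ (-4 : ℝ) := by
    intro y hy
    obtain ⟨-, hR⟩ := hΔsrc hC₃ hy h₃'
    exact hR.trans (mul_le_mul_of_nonneg_right (by nlinarith) (hpow0 y _))
  have hdec₃ : ∀ y : E3, RB ≤ ‖y‖ → |endValue e v y| ≤ C₃ * ‖y‖ ^ (-1 : ℝ) := fun y hy =>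
    (h₃' y (le_trans (le_trans (le_max_left _ _) (le_max_left _ _)) hy)).1
  /- ── the monopole term ── -/
  obtain ⟨A, C₄, R₄, h₄⟩ := e.exists_monopole_of_laplacian D hAF hρ0 hu hdec₃ hR₄ hΔ₅
  set C₄' : ℝ := max C₄ 0 with hC₄'
  have h₄' : ∀ y : E3, R₄ ≤ ‖y‖ → |endValue e v y - A * ‖y‖⁻¹| ≤ C₄' * ‖y‖ ^ (-(2 : ℝ)) :=
    fun y hy => (h₄ y hy).trans (mul_le_mul_of_nonneg_right (le_max_left _ _) (hpow0 y _))
  /- ── Stage 3: the bootstrap for `Ω = v̂ − A/r` ── -/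
  have hΩ : ContDiffOn ℝ ∞ (fun z => endValue e v z - A * ‖z‖⁻¹) {y : E3 | e.R < ‖y‖} :=
    hu.sub (contDiffOn_const.mul (contDiffOn_inv_norm hρ0))
  have heqΩ := fun (y : E3) (hy : e.R < ‖y‖) => sub_monopole_equation b (u := endValue e v)
      (g := fun y => 8⁻¹ * e.scalarCurvatureCoeff D y)
      (a := fun k l y => MetricCoord.ginv (e.hCoeff D) b.toBasis y l k)
      (β := fun m y => -(2⁻¹ * ∑ k, ∑ l, ∑ j, MetricCoord.ginv (e.hCoeff D) b.toBasis y k l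
            * MetricCoord.ginv (e.hCoeff D) b.toBasis y m j
            * MetricCoord.koszulCLM (e.hCoeff D) y (b k) (b l) (b j)))
      (c := fun y => -8⁻¹ * e.scalarCurvatureCoeff D y) hρ0 hu heq A hy
  have hg₃ : IsBigOSmooth 2 (-4) fun y ↦ 8⁻¹ * e.scalarCurvatureCoeff D y - A *
      (∑ k, ∑ l, (MetricCoord.ginv (e.hCoeff D) b.toBasis y l k - if k = l then 1 else 0)
          * fderiv ℝ (fun z => fderiv ℝ (fun z' : E3 => ‖z'‖⁻¹) z (b k)) y (b l)
        + ∑ m, (-(2⁻¹ * ∑ k, ∑ l, ∑ j, MetricCoord.ginv (e.hCoeff D) b.toBasis y k l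
            * MetricCoord.ginv (e.hCoeff D) b.toBasis y m j
            * MetricCoord.koszulCLM (e.hCoeff D) y (b k) (b l) (b j)))
          * fderiv ℝ (fun z' : E3 => ‖z'‖⁻¹) y (b m)
        + (-8⁻¹ * e.scalarCurvatureCoeff D y) * ‖y‖⁻¹) :=
    hg.sub (((e.isBigOSmooth_monopoleError D b hH4).const_mul A).mono (by norm_num))
  have hI₃ : ∀ x : E3, max (4 / 3 * R₄) 1 ≤ ‖x‖ →
      ∫ y in closedBall x (1 / 4 * ‖x‖), (endValue e v y - A * ‖y‖⁻¹) ^ 2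
        ≤ 6 * 64 * C₄' ^ 2 * ‖x‖ ^ (-1 : ℝ) := by
    intro x hx
    have h := setIntegral_quarterBall_sq_le (f := fun y => endValue e v y - A * ‖y‖⁻¹)
      (le_max_right _ _) zero_le_two (by norm_num) h₄' hx
    rwa [show (-(2 * 2) + 3 : ℝ) = -1 by norm_num] at h
  obtain ⟨C₅, r₅, hC₅, h₅⟩ := e.bootstrap_stage D b hH4 (u := fun z => endValue e v z - A * ‖z‖⁻¹)
    (q := -1) (by norm_num) hΩ hg₃ heqΩ (by positivity) hI₃
  have h₅' : ∀ y : E3, r₅ ≤ ‖y‖ → |endValue e v y - A * ‖y‖⁻¹| ≤ C₅ * ‖y‖ ^ (-2 : ℝ) ∧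
      (∀ m, |fderiv ℝ (fun z => endValue e v z - A * ‖z‖⁻¹) y (b m)| ≤ C₅ * ‖y‖ ^ (-3 : ℝ)) ∧
      (∀ m n, |fderiv ℝ (fun z => fderiv ℝ (fun z' => endValue e v z' - A * ‖z'‖⁻¹) z (b m)) y (b n)|
        ≤ C₅ * ‖y‖ ^ (-4 : ℝ)) := by
    intro y hy
    obtain ⟨h0, h1', h2'⟩ := h₅ y hy
    refine ⟨by rwa [show ((-1 : ℝ) - 3) / 2 = -2 by norm_num] at h0, fun m => ?_, fun m n => ?_⟩
    · have := h1' m; rwa [show ((-1 : ℝ) - 5) / 2 = -3 by norm_num] at this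
    · have := h2' m n; rwa [show ((-1 : ℝ) - 7) / 2 = -4 by norm_num] at this
  /- ── conclusion: the `O₂(r⁻²)` expansion ── -/
  refine ⟨A, fun m hm => ?_⟩
  have hfun : (fun y ↦ endValue e v y - A / ‖y‖) = fun z => endValue e v z - A * ‖z‖⁻¹ := by
    funext y; rw [div_eq_mul_inv]
  rw [hfun]
  have hev : ∀ᶠ x in cobounded E3, max r₅ (e.R + 1) < ‖x‖ := eventually_cobounded_lt_norm _
  interval_cases m
  · refine IsBigO.of_bound C₅ ?_
    filter_upwards [hev] with x hx
    have hx5 : r₅ ≤ ‖x‖ := by linarith [le_max_left r₅ (e.R + 1)]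
    rw [norm_norm, norm_iteratedFDeriv_zero, Real.norm_eq_abs, Real.norm_of_nonneg (hpow0 x _)]
    have h := (h₅' x hx5).1
    norm_num at h ⊢
    exact h
  · refine IsBigO.of_bound (3 * C₅) ?_
    filter_upwards [hev] with x hx
    have hx5 : r₅ ≤ ‖x‖ := by linarith [le_max_left r₅ (e.R + 1)]
    rw [norm_norm, Real.norm_of_nonneg (hpow0 x _)]
    have h := (h₅' x hx5).2.1
    calc ‖iteratedFDeriv ℝ 1 (fun z => endValue e v z - A * ‖z‖⁻¹) x‖
        ≤ ∑ i, |fderiv ℝ (fun z => endValue e v z - A * ‖z‖⁻¹) x (b i)| :=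
          norm_iteratedFDeriv_one_le_sum b _ x
      _ ≤ ∑ _i : Fin 3, C₅ * ‖x‖ ^ (-3 : ℝ) := Finset.sum_le_sum fun i _ => h i
      _ = 3 * C₅ * ‖x‖ ^ (-2 - ((1 : ℕ) : ℝ)) := by
          rw [Finset.sum_const, Finset.card_univ, Fintype.card_fin]
          norm_num
          ring
  · refine IsBigO.of_bound (9 * C₅) ?_
    filter_upwards [hev] with x hx
    have hx5 : r₅ ≤ ‖x‖ := by linarith [le_max_left r₅ (e.R + 1)]
    have hxR : e.R < ‖x‖ := by linarith [le_max_right r₅ (e.R + 1)]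
    rw [norm_norm, Real.norm_of_nonneg (hpow0 x _)]
    have h := (h₅' x hx5).2.2
    have hΩ2 : ContDiffAt ℝ 2 (fun z => endValue e v z - A * ‖z‖⁻¹) x :=
      (hΩ.contDiffAt (hU.mem_nhds hxR)).of_le (by norm_cast)
    calc ‖iteratedFDeriv ℝ 2 (fun z => endValue e v z - A * ‖z‖⁻¹) x‖
        ≤ ∑ i, ∑ j, |fderiv ℝ (fun z => fderiv ℝ (fun z' => endValue e v z' - A * ‖z'‖⁻¹) z (b j)) x (b i)| :=
          norm_iteratedFDeriv_two_le_sum b hΩ2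
      _ ≤ ∑ _i : Fin 3, ∑ _j : Fin 3, C₅ * ‖x‖ ^ (-4 : ℝ) :=
          Finset.sum_le_sum fun i _ => Finset.sum_le_sum fun j _ => h j i
      _ = 9 * C₅ * ‖x‖ ^ (-2 - ((2 : ℕ) : ℝ)) := by
          rw [Finset.sum_const, Finset.card_univ, Fintype.card_fin, Finset.sum_const,
            Finset.card_univ, Fintype.card_fin]
          norm_num
          ring

end Literature.Geometry.Lorentzian
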